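import Literature.MathematicalPhysics.QuantumFieldTheory.Balaban1983to89.T4GaugeActionRatePair
import Literature.MathematicalPhysics.QuantumFieldTheory.Balaban1983to89.Beta.AliasRatioStrip

/-!
# T4Rate166StripDirect — the DIRECT η-rate of the continued (1.66) multiplier on the FULL zero-free strip at the
FULL King exponent `n⁻²`, hypothesis-free (U = 1 linear theory, finite tori, rung (B)+1)

Cell pub-balaban, T⁴-continuum sub-cell, node U1a, spine estimate NE2 (η-RATE, LINEAR THEORY), prover seat P2
(technique: direct spectral/Fourier estimate of the linear block-spin map's contraction in Bałaban's axial gauge at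
`U = 1`), generation 4.  HONEST FRAMING: finite tori / the unit lattice `ℤ^{d+1}`, background `U = 1`, no `BetaPertH`, no
`(B)`, no `(B^μ)`; NOT infinite volume, NOT a mass gap, NOT Clay.

## What is proved

For Bałaban's averaged gauge-field propagator symbol of [Balaban1984PropagatorsI] (1.66) p. 29 continued to the complex
strip (b05-g9 `B5Symbol166.W166 n μ ν`, zero-free on `B4Strip.Strip d κ` for `0 ≤ κ ≤ B5Symbol166Strip.kappa166 d`):

* `W166_rate` — for ALL levels `1 ≤ n ≤ m` (no divisibility needed), all `μ, ν`, every `p ∈ Strip d κ`: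
  `‖W166 m μ ν p − W166 n μ ν p‖ ≤ C166 d · n⁻²`, `C166 d` explicit in `d`.
  This is King's exponent ([King1986] (4.31) p. 673: `|Δ^{(k+n)}(p′+l)⁻¹ − Δ^{(k)}(p′+l)⁻¹| ≤ CL^{−2k}`, `n = L^k`, and
  Lemma 4.5 (4.38) p. 674) on the WHOLE zero-free strip — closing the lineage record's open point (N5): gen 2's
  `T4GaugeActionRateStrip.W166_strip_rate` had `n⁻¹` on the shrunk strip `Strip d (κ₁₆₆/(4d))` by three-lines interpolation.
* the CONTINUUM multiplier (§3): `W166lim μ ν p := lim_n W166 n μ ν p` exists on the zero-free strip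
  (`tendsto_W166lim`), with `‖W166lim μ ν p − W166 n μ ν p‖ ≤ C166 d · n⁻²` for every `n ≥ 1` (`W166lim_rate`) and
  `‖W166lim μ ν p‖ ≤ MW d` (`norm_W166lim_le`).
* position space at the full exponent and full width (§3): `Gsym_rate`, `stripRegular_W166_sub2`, `stripRegular_Gsym_sub2`,
  `latticeKernel_Gsym_rate2` (`8·C166(d+1)·n⁻²·e^{−κ₁₆₆(d+1)|x|_∞}` on `ℤ^{d+1}`), `ksum_rate2` (torus, uniformly in the
  volume), `kerRe_step2`, and the `RatePair` of the (1.66) entry kernels with `θ = L⁻²` and `δ = κ₁₆₆(d+1)/(d+1)`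
  (`ratePair_kerFamily2`; gen 2's `T4GaugeActionRatePair.ratePair_kerFamily` had `θ = L⁻¹`, `δ = δ₁₆₆`).

## Method (all [folklore]; King's p. 673 mechanism ((4.31) from (4.7)) made quantitative on the complex strip)

§1 one-variable leaf rates under refinement `n → m` on the fat box `|Re z| ≤ π + 1/4`, `|Im z| ≤ 1/2`:
the second-difference symbol `S_ξ^{(n)}(w) = n²(2 − 2cos(w/n))` satisfies `‖S_ξ^{(m)}(w) − S_ξ^{(n)}(w)‖ ≤ 4‖w‖⁴e^{‖w‖/n}/n²`
(exp-series Taylor remainder, Mathlib `Complex.norm_exp_sub_sum_le_norm_mul_exp`) and `‖S_ξ^{(n)}(w)‖ ≥ ‖w‖²/32` on the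
EXTENDED range `|Re w| ≤ πn + π + 1/4` (`n ≥ 2`); hence the inverse symbols converge ABSOLUTELY at rate `Cinv/n²` with NO
loss in the alias index.  The aliases `j ∈ ℤ_n` of level `n` are paired with aliases `ι(j) ∈ ℤ_m` of level `m` by the
CENTRED PAIRING (`ι(j) = j` for `2j < n`, `ι(j) = j + m − n` otherwise; both shifted symbols are then the SAME function of
the recentred variable `wc n j z` by `2πn`- resp. `2πm`-periodicity); unpaired aliases of level `m` have `ω_m ≥ n/2` and
are `O(n⁻²)`-small through the shifted inverse Laplacian (`B4StripSums.re_DeltaXi_shift_ge_W`).  §2 assembles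
`uFactor → U → (summand of R̃) → R̃ → c, Δ, Y → F → W` by a small rate-and-bound calculus (`RB`), the alias sums being
uniformly summable through `Σ_j 64/ω_n(j)² ≤ 256`.  §3 re-instantiates gen 2's position-space chain by name.

Tree inputs BY NAME (nothing restated as a hypothesis): b05 `B4Strip*`, `B5Symbol166*`, `B5Kernel166Decay`,
`B4ContourShift`, `B4TorusKernel`; this lineage's `T4GaugeActionRateStrip` / `T4GaugeActionRatePair` (for §3 shapes).
-/

namespace Literature.MathematicalPhysics.QuantumFieldTheory.Balaban1983to89.T4Rate166StripDirect

open scoped BigOperators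
open Finset Complex
open Literature.MathematicalPhysics.QuantumFieldTheory.Balaban1983to89.B4Strip
open Literature.MathematicalPhysics.QuantumFieldTheory.Balaban1983to89.B4StripCauchy
open Literature.MathematicalPhysics.QuantumFieldTheory.Balaban1983to89.B4StripSums
  (omega omega_pos one_le_omega omega_zero omega_le_left omega_le_right W W_nonneg one_le_W omega_sq_le_W
    re_DeltaXi_shift_ge_W inv_sq_le_omega)
open Literature.MathematicalPhysics.QuantumFieldTheory.Balaban1983to89.B5Symbol166
open Literature.MathematicalPhysics.QuantumFieldTheory.Balaban1983to89.B5Symbol166Strip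

noncomputable section

variable {d : ℕ}

/-! ## §0  A rate-and-bound calculus -/

/-- `RB a b B ρ`: both values bounded by `B` and their difference bounded by `ρ`. [folklore] -/
structure RB (a b : ℂ) (B ρ : ℝ) : Prop where
  left : ‖a‖ ≤ B
  right : ‖b‖ ≤ B
  sub : ‖a - b‖ ≤ ρ

namespace RB

variable {a b a' b' : ℂ} {B ρ B' ρ' : ℝ}

/-- `0 ≤ B`. [folklore] -/
theorem B_nonneg (h : RB a b B ρ) : 0 ≤ B := (norm_nonneg _).trans h.left

/-- `0 ≤ ρ`. [folklore] -/
theorem ρ_nonneg (h : RB a b B ρ) : 0 ≤ ρ := (norm_nonneg _).trans h.sub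

/-- weakening. [folklore] -/
theorem mono (h : RB a b B ρ) {B₁ ρ₁ : ℝ} (hB : B ≤ B₁) (hρ : ρ ≤ ρ₁) : RB a b B₁ ρ₁ :=
  ⟨h.left.trans hB, h.right.trans hB, h.sub.trans hρ⟩

/-- a level-independent value. [folklore] -/
theorem of_eq (a : ℂ) (h : ‖a‖ ≤ B) : RB a a B 0 := ⟨h, h, by simp⟩

/-- products: `‖aa′ − bb′‖ ≤ B ρ′ + ρ B′`. [folklore] -/
theorem mul (h : RB a b B ρ) (h' : RB a' b' B' ρ') : RB (a * a') (b * b') (B * B') (B * ρ' + ρ * B') := by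
  refine ⟨?_, ?_, ?_⟩
  · rw [norm_mul]; exact mul_le_mul h.left h'.left (norm_nonneg _) h.B_nonneg
  · rw [norm_mul]; exact mul_le_mul h.right h'.right (norm_nonneg _) h.B_nonneg
  · have e : a * a' - b * b' = a * (a' - b') + (a - b) * b' := by ring
    rw [e]
    calc ‖a * (a' - b') + (a - b) * b'‖ ≤ ‖a * (a' - b')‖ + ‖(a - b) * b'‖ := norm_add_le _ _
      _ = ‖a‖ * ‖a' - b'‖ + ‖a - b‖ * ‖b'‖ := by rw [norm_mul, norm_mul]
      _ ≤ B * ρ' + ρ * B' := add_le_add (mul_le_mul h.left h'.sub (norm_nonneg _) h.B_nonneg)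
          (mul_le_mul h.sub h'.right (norm_nonneg _) h.ρ_nonneg)

/-- sums. [folklore] -/
theorem add (h : RB a b B ρ) (h' : RB a' b' B' ρ') : RB (a + a') (b + b') (B + B') (ρ + ρ') := by
  refine ⟨(norm_add_le _ _).trans (add_le_add h.left h'.left),
    (norm_add_le _ _).trans (add_le_add h.right h'.right), ?_⟩
  have e : a + a' - (b + b') = (a - b) + (a' - b') := by ring
  rw [e]; exact (norm_add_le _ _).trans (add_le_add h.sub h'.sub)

/-- finite sums with uniform data. [folklore] -/
theorem sum {ι : Type*} (s : Finset ι) {f g : ι → ℂ} {B ρ : ℝ}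
    (h : ∀ i ∈ s, RB (f i) (g i) B ρ) :
    RB (∑ i ∈ s, f i) (∑ i ∈ s, g i) (s.card * B) (s.card * ρ) := by
  classical
  induction s using Finset.induction_on with
  | empty => exact ⟨by simp, by simp, by simp⟩
  | @insert j s hj ih =>
    have h1 := h j (Finset.mem_insert_self j s)
    have h2 := ih (fun i hi => h i (Finset.mem_insert_of_mem hi))
    have h3 := h1.add h2
    rw [Finset.sum_insert hj, Finset.sum_insert hj, Finset.card_insert_of_notMem hj]
    push_cast
    refine h3.mono (by ring_nf; exact le_rfl) (by ring_nf; exact le_rfl)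

/-- finite products with a uniform bound `B ≥ 1` and a uniform rate. [folklore] -/
theorem prod {ι : Type*} (s : Finset ι) {f g : ι → ℂ} {B ρ : ℝ} (hB : 1 ≤ B) (hρ : 0 ≤ ρ)
    (h : ∀ i ∈ s, RB (f i) (g i) B ρ) :
    RB (∏ i ∈ s, f i) (∏ i ∈ s, g i) (B ^ s.card) (s.card * B ^ s.card * ρ) := by
  classical
  induction s using Finset.induction_on with
  | empty => exact ⟨by simp, by simp, by simp⟩
  | @insert j s hj ih =>
    have h1 := h j (Finset.mem_insert_self j s)
    have h2 := ih (fun i hi => h i (Finset.mem_insert_of_mem hi))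
    have h3 := h1.mul h2
    rw [Finset.prod_insert hj, Finset.prod_insert hj, Finset.card_insert_of_notMem hj]
    refine h3.mono (by rw [pow_succ]; ring_nf; exact le_rfl) ?_
    have hBc : 0 ≤ B ^ s.card := pow_nonneg (by linarith) _
    have hBB : B ^ s.card ≤ B ^ (s.card + 1) := pow_le_pow_right₀ hB (Nat.le_succ _)
    push_cast
    have : ρ * B ^ s.card ≤ ρ * B ^ (s.card + 1) := mul_le_mul_of_nonneg_left hBB hρ
    calc B * (s.card * B ^ s.card * ρ) + ρ * B ^ s.card
        = s.card * B ^ (s.card + 1) * ρ + ρ * B ^ s.card := by rw [pow_succ]; ring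
      _ ≤ s.card * B ^ (s.card + 1) * ρ + ρ * B ^ (s.card + 1) := by linarith
      _ = (s.card + 1) * B ^ (s.card + 1) * ρ := by ring

/-- powers with `B ≥ 1`. [folklore] -/
theorem pow (h : RB a b B ρ) (hB : 1 ≤ B) (j : ℕ) : RB (a ^ j) (b ^ j) (B ^ j) (j * B ^ j * ρ) := by
  have := RB.prod (Finset.range j) (f := fun _ => a) (g := fun _ => b) hB h.ρ_nonneg (fun _ _ => h)
  simpa using this

/-- finite products with individual bounds `c_i > 0` and a uniform rate: the rate of the product is
`ρ · (Π c) · Σ c_i⁻¹`. [folklore] -/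
theorem prod_inv {ι : Type*} (s : Finset ι) {f g : ι → ℂ} {c : ι → ℝ} {ρ : ℝ}
    (hc : ∀ i ∈ s, 0 < c i) (h : ∀ i ∈ s, RB (f i) (g i) (c i) ρ) :
    RB (∏ i ∈ s, f i) (∏ i ∈ s, g i) (∏ i ∈ s, c i) (ρ * (∏ i ∈ s, c i) * ∑ i ∈ s, (c i)⁻¹) := by
  classical
  induction s using Finset.induction_on with
  | empty => exact ⟨by simp, by simp, by simp⟩
  | @insert j s hj ih =>
    have h1 := h j (Finset.mem_insert_self j s)
    have hc' : ∀ i ∈ s, 0 < c i := fun i hi => hc i (Finset.mem_insert_of_mem hi)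
    have h2 := ih hc' (fun i hi => h i (Finset.mem_insert_of_mem hi))
    have h3 := h1.mul h2
    have hcj : 0 < c j := hc j (Finset.mem_insert_self j s)
    rw [Finset.prod_insert hj, Finset.prod_insert hj, Finset.prod_insert hj, Finset.sum_insert hj]
    refine h3.mono le_rfl (le_of_eq ?_)
    field_simp
    ring

end RB

/-- quotients: `‖a/a′ − b/b′‖ ≤ ρ/c₀ + B ρ′/c₀²` when `‖a‖ ≤ B`, `‖a − b‖ ≤ ρ`, `‖a′ − b′‖ ≤ ρ′`, `‖a′‖, ‖b′‖ ≥ c₀ > 0`.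
[folklore] -/
theorem norm_div_sub_div_le {a b a' b' : ℂ} {B ρ ρ' c₀ : ℝ} (hc : 0 < c₀) (ha : ‖a‖ ≤ B) (hab : ‖a - b‖ ≤ ρ)
    (hab' : ‖a' - b'‖ ≤ ρ') (ha' : c₀ ≤ ‖a'‖) (hb' : c₀ ≤ ‖b'‖) :
    ‖a / a' - b / b'‖ ≤ ρ / c₀ + B * ρ' / c₀ ^ 2 := by
  have ha0 : a' ≠ 0 := fun h => by rw [h, norm_zero] at ha'; linarith
  have hb0 : b' ≠ 0 := fun h => by rw [h, norm_zero] at hb'; linarith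
  have e : a / a' - b / b' = (a - b) / b' + a * ((b' - a') / (a' * b')) := by
    field_simp; ring
  rw [e]
  have hB : 0 ≤ B := (norm_nonneg _).trans ha
  have hρ' : 0 ≤ ρ' := (norm_nonneg _).trans hab'
  calc ‖(a - b) / b' + a * ((b' - a') / (a' * b'))‖
      ≤ ‖(a - b) / b'‖ + ‖a * ((b' - a') / (a' * b'))‖ := norm_add_le _ _
    _ = ‖a - b‖ / ‖b'‖ + ‖a‖ * (‖b' - a'‖ / (‖a'‖ * ‖b'‖)) := by
        rw [norm_div, norm_mul, norm_div, norm_mul]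
    _ ≤ ρ / c₀ + B * (ρ' / (c₀ * c₀)) := by
        have hρ : 0 ≤ ρ := (norm_nonneg _).trans hab
        have i1 : ‖a - b‖ / ‖b'‖ ≤ ρ / c₀ := div_le_div₀ hρ hab hc hb'
        have i2 : ‖b' - a'‖ / (‖a'‖ * ‖b'‖) ≤ ρ' / (c₀ * c₀) := by
          rw [norm_sub_rev]
          exact div_le_div₀ hρ' hab' (mul_pos hc hc) (mul_le_mul ha' hb' hc.le (norm_nonneg _))
        have i3 := mul_le_mul ha i2 (by positivity) hB
        linarith
    _ = ρ / c₀ + B * ρ' / c₀ ^ 2 := by ring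

/-! ## §1  One-variable leaf rates under refinement -/

/-- `‖2 − 2cos x − x²‖ ≤ 2‖x‖⁴e^{‖x‖}` for every complex `x` (fourth-order Taylor remainder of the exponential series).
[folklore] -/
theorem norm_two_sub_two_cos_sub_sq_le (x : ℂ) :
    ‖2 - 2 * Complex.cos x - x ^ 2‖ ≤ 2 * ‖x‖ ^ 4 * Real.exp ‖x‖ := by
  have h1 := Complex.norm_exp_sub_sum_le_norm_mul_exp (x * I) 4
  have h2 := Complex.norm_exp_sub_sum_le_norm_mul_exp (-x * I) 4
  have hs : ∑ m ∈ Finset.range 4, (x * I) ^ m / (m.factorial : ℂ)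
      + ∑ m ∈ Finset.range 4, (-x * I) ^ m / (m.factorial : ℂ) = 2 - x ^ 2 := by
    simp only [Finset.sum_range_succ, Finset.sum_range_zero, Nat.factorial, Nat.succ_eq_add_one]
    push_cast
    linear_combination x ^ 2 * Complex.I_sq
  have e : 2 - 2 * Complex.cos x - x ^ 2
      = -((Complex.exp (x * I) - ∑ m ∈ Finset.range 4, (x * I) ^ m / (m.factorial : ℂ))
        + (Complex.exp (-x * I) - ∑ m ∈ Finset.range 4, (-x * I) ^ m / (m.factorial : ℂ))) := by
    rw [Complex.two_cos]
    linear_combination (-1 : ℂ) * hs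
  rw [e, norm_neg]
  have n1 : ‖x * I‖ = ‖x‖ := by rw [norm_mul, Complex.norm_I, mul_one]
  have n2 : ‖-x * I‖ = ‖x‖ := by rw [norm_mul, norm_neg, Complex.norm_I, mul_one]
  rw [n1] at h1
  rw [n2] at h2
  calc _ ≤ _ := norm_add_le _ _
    _ ≤ ‖x‖ ^ 4 * Real.exp ‖x‖ + ‖x‖ ^ 4 * Real.exp ‖x‖ := add_le_add h1 h2
    _ = 2 * ‖x‖ ^ 4 * Real.exp ‖x‖ := by ring

/-- `‖S_ξ^{(n)}(w) − w²‖ ≤ 2‖w‖⁴ e^{‖w‖/n}/n²` (`n ≥ 1`). [folklore] -/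
theorem norm_Sxi_sub_sq_le (n : ℕ) (hn : 1 ≤ n) (w : ℂ) :
    ‖Sxi n w - w ^ 2‖ ≤ 2 * ‖w‖ ^ 4 * Real.exp (‖w‖ / n) / (n : ℝ) ^ 2 := by
  have hn0 : (n : ℂ) ≠ 0 := Nat.cast_ne_zero.mpr (by omega)
  have hnr : (0 : ℝ) < n := by exact_mod_cast (show 0 < n by omega)
  have e : Sxi n w - w ^ 2 = (n : ℂ) ^ 2 * (2 - 2 * Complex.cos (w / n) - (w / n) ^ 2) := by
    unfold Sxi; field_simp
  rw [e, norm_mul, norm_pow, Complex.norm_natCast]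
  have h := norm_two_sub_two_cos_sub_sq_le (w / n)
  have hw : ‖w / (n : ℂ)‖ = ‖w‖ / n := by rw [norm_div, Complex.norm_natCast]
  rw [hw] at h
  calc (n : ℝ) ^ 2 * ‖2 - 2 * Complex.cos (w / n) - (w / n) ^ 2‖
      ≤ (n : ℝ) ^ 2 * (2 * (‖w‖ / n) ^ 4 * Real.exp (‖w‖ / n)) := by gcongr
    _ = 2 * ‖w‖ ^ 4 * Real.exp (‖w‖ / n) / (n : ℝ) ^ 2 := by field_simp

/-- the refinement rate of the second-difference symbol: `‖S_ξ^{(m)}(w) − S_ξ^{(n)}(w)‖ ≤ 4‖w‖⁴e^{‖w‖/n}/n²`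
for `1 ≤ n ≤ m`. [folklore] -/
theorem norm_Sxi_sub_Sxi_le {n m : ℕ} (hn : 1 ≤ n) (hnm : n ≤ m) (w : ℂ) :
    ‖Sxi m w - Sxi n w‖ ≤ 4 * ‖w‖ ^ 4 * Real.exp (‖w‖ / n) / (n : ℝ) ^ 2 := by
  have hm : 1 ≤ m := hn.trans hnm
  have hnr : (0 : ℝ) < n := by exact_mod_cast (show 0 < n by omega)
  have hmr : (n : ℝ) ≤ m := by exact_mod_cast hnm
  have h1 := norm_Sxi_sub_sq_le n hn w
  have h2 := norm_Sxi_sub_sq_le m hm w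
  have hexp : Real.exp (‖w‖ / m) ≤ Real.exp (‖w‖ / n) :=
    Real.exp_le_exp.mpr (div_le_div_of_nonneg_left (norm_nonneg _) hnr hmr)
  have hsq : (1 : ℝ) / (m : ℝ) ^ 2 ≤ 1 / (n : ℝ) ^ 2 :=
    one_div_le_one_div_of_le (by positivity) (pow_le_pow_left₀ hnr.le hmr 2)
  have hA : 0 ≤ 2 * ‖w‖ ^ 4 * Real.exp (‖w‖ / n) := by positivity
  have h2' : ‖Sxi m w - w ^ 2‖ ≤ 2 * ‖w‖ ^ 4 * Real.exp (‖w‖ / n) / (n : ℝ) ^ 2 := by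
    calc ‖Sxi m w - w ^ 2‖ ≤ 2 * ‖w‖ ^ 4 * Real.exp (‖w‖ / m) / (m : ℝ) ^ 2 := h2
      _ ≤ 2 * ‖w‖ ^ 4 * Real.exp (‖w‖ / n) / (m : ℝ) ^ 2 := by gcongr
      _ = 2 * ‖w‖ ^ 4 * Real.exp (‖w‖ / n) * (1 / (m : ℝ) ^ 2) := by ring
      _ ≤ 2 * ‖w‖ ^ 4 * Real.exp (‖w‖ / n) * (1 / (n : ℝ) ^ 2) := mul_le_mul_of_nonneg_left hsq hA
      _ = 2 * ‖w‖ ^ 4 * Real.exp (‖w‖ / n) / (n : ℝ) ^ 2 := by ring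
  have e : Sxi m w - Sxi n w = (Sxi m w - w ^ 2) - (Sxi n w - w ^ 2) := by ring
  rw [e]
  calc _ ≤ ‖Sxi m w - w ^ 2‖ + ‖Sxi n w - w ^ 2‖ := norm_sub_le _ _
    _ ≤ _ := add_le_add h2' h1
    _ = 4 * ‖w‖ ^ 4 * Real.exp (‖w‖ / n) / (n : ℝ) ^ 2 := by ring

/-- `u²/32 ≤ sin² u` on `|u| ≤ 3π/4 + 1/16` (Jordan on `[0, π/2]`, and `sin u = sin(π − u) ≥ 0.46` beyond). [folklore] -/
theorem sq_div_le_sin_sq {u : ℝ} (hu : |u| ≤ 3 * Real.pi / 4 + 1 / 16) : u ^ 2 / 32 ≤ Real.sin u ^ 2 := by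
  have hπlo := Real.pi_gt_d2
  have hπhi := Real.pi_lt_d2
  have key : ∀ a : ℝ, 0 ≤ a → a ≤ 3 * Real.pi / 4 + 1 / 16 → a ^ 2 / 32 ≤ Real.sin a ^ 2 := by
    intro a ha0 ha1
    rcases le_or_gt a (Real.pi / 2) with h | h
    · have hj := jordan_sq (u := a) (by rw [abs_of_nonneg ha0]; exact h)
      have hπ2 : 0 < Real.pi ^ 2 := by positivity
      have h32 : (1 : ℝ) / 32 ≤ 4 / Real.pi ^ 2 := by
        rw [div_le_div_iff₀ (by norm_num) hπ2]; nlinarith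
      calc a ^ 2 / 32 = 1 / 32 * a ^ 2 := by ring
        _ ≤ 4 / Real.pi ^ 2 * a ^ 2 := mul_le_mul_of_nonneg_right h32 (sq_nonneg a)
        _ ≤ Real.sin a ^ 2 := hj
    · have hs : Real.sin a = Real.sin (Real.pi - a) := (Real.sin_pi_sub a).symm
      have hb0 : 0 ≤ Real.pi - a := by linarith
      have hb1 : Real.pi - a ≤ Real.pi / 2 := by linarith
      have hjor := Real.mul_le_sin hb0 hb1
      have hlow : (0.46 : ℝ) ≤ 2 / Real.pi * (Real.pi - a) := by
        rw [div_mul_eq_mul_div, le_div_iff₀ Real.pi_pos]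
        linarith
      have hsin : (0.46 : ℝ) ≤ Real.sin a := by rw [hs]; linarith
      have hsq : (0.46 : ℝ) ^ 2 ≤ Real.sin a ^ 2 := pow_le_pow_left₀ (by norm_num) hsin 2
      have ha2 : a ^ 2 ≤ (2.425 : ℝ) ^ 2 := pow_le_pow_left₀ ha0 (by linarith) 2
      nlinarith
  rcases le_or_gt 0 u with h0 | h0
  · exact key u h0 ((le_abs_self u).trans hu)
  · have := key (-u) (by linarith) ((neg_le_abs u).trans hu)
    simpa [Real.sin_neg] using this

/-- the quadratic lower bound on the EXTENDED range: `‖S_ξ^{(n)}(w)‖ ≥ ‖w‖²/32` for `n ≥ 2`, `|Re w| ≤ πn + π + 1/4`.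
[folklore] -/
theorem norm_Sxi_ge_sq_div (n : ℕ) (hn : 2 ≤ n) {w : ℂ} (hx : |w.re| ≤ Real.pi * n + Real.pi + 1 / 4) :
    ‖w‖ ^ 2 / 32 ≤ ‖Sxi n w‖ := by
  have hn0 : n ≠ 0 := by omega
  have hnr : (2 : ℝ) ≤ n := by exact_mod_cast hn
  have hnpos : (0 : ℝ) < n := by linarith
  rw [norm_Sxi_eq n hn0 w]
  have hu : |w.re / (2 * n)| ≤ 3 * Real.pi / 4 + 1 / 16 := by
    rw [abs_div, abs_of_pos (by positivity : (0 : ℝ) < 2 * n), div_le_iff₀ (by positivity)]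
    have hπ := Real.pi_pos
    nlinarith
  have h1 := sq_div_le_sin_sq hu
  have h2 : (w.im / (2 * n)) ^ 2 ≤ Real.sinh (w.im / (2 * n)) ^ 2 := by
    -- `v² ≤ sinh² v` (cf. the private `B4StripCauchy.sq_le_sinh_sq`)
    have h : |w.im / (2 * n)| ≤ Real.sinh |w.im / (2 * n)| := Real.self_le_sinh_iff.mpr (abs_nonneg _)
    rw [← Real.abs_sinh] at h
    rw [← sq_abs (w.im / (2 * n)), ← sq_abs (Real.sinh _)]
    exact pow_le_pow_left₀ (abs_nonneg _) h 2
  have e1 : 4 * (n : ℝ) ^ 2 * ((w.re / (2 * n)) ^ 2 / 32) = w.re ^ 2 / 32 := by field_simp; ring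
  have e2 : 4 * (n : ℝ) ^ 2 * (w.im / (2 * n)) ^ 2 = w.im ^ 2 := by field_simp; ring
  have h1' := mul_le_mul_of_nonneg_left h1 (by positivity : (0 : ℝ) ≤ 4 * (n : ℝ) ^ 2)
  have h2' := mul_le_mul_of_nonneg_left h2 (by positivity : (0 : ℝ) ≤ 4 * (n : ℝ) ^ 2)
  rw [e1] at h1'
  rw [e2] at h2'
  have hw : ‖w‖ ^ 2 = w.re ^ 2 + w.im ^ 2 := by
    rw [Complex.sq_norm, Complex.normSq_apply]; ring
  rw [hw]
  nlinarith [sq_nonneg w.im]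

/-- the constant of the inverse-symbol rate. [folklore] -/
def Cinv : ℝ := 4096 * Real.exp (Real.pi + 2)

/-- `0 < Cinv`. [folklore] -/
theorem Cinv_pos : 0 < Cinv := by unfold Cinv; positivity

/-- **ABSOLUTE rate of the inverse symbols on the extended range**: for `2 ≤ n ≤ m`, `w ≠ 0`,
`|Re w| ≤ πn + π + 1/4`, `|Im w| ≤ 1/2`:  `‖S_ξ^{(m)}(w)⁻¹ − S_ξ^{(n)}(w)⁻¹‖ ≤ Cinv/n²` — the `‖w‖⁴` of the Taylor
remainder cancels EXACTLY against the two quadratic lower bounds (King's mechanism, (4.31) p. 673, from (4.7)). [folklore] -/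
theorem norm_inv_Sxi_sub_le {n m : ℕ} (hn : 2 ≤ n) (hnm : n ≤ m) {w : ℂ} (hw : w ≠ 0)
    (hx : |w.re| ≤ Real.pi * n + Real.pi + 1 / 4) (hy : |w.im| ≤ 1 / 2) :
    ‖(Sxi m w)⁻¹ - (Sxi n w)⁻¹‖ ≤ Cinv / (n : ℝ) ^ 2 := by
  have hm : 2 ≤ m := hn.trans hnm
  have hnr : (2 : ℝ) ≤ n := by exact_mod_cast hn
  have hmr : (n : ℝ) ≤ m := by exact_mod_cast hnm
  have hnpos : (0 : ℝ) < n := by linarith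
  have hxm : |w.re| ≤ Real.pi * m + Real.pi + 1 / 4 := by nlinarith [Real.pi_pos]
  have ln := norm_Sxi_ge_sq_div n hn hx
  have lm := norm_Sxi_ge_sq_div m hm hxm
  have hw2 : 0 < ‖w‖ ^ 2 := by positivity
  have hSn : Sxi n w ≠ 0 := fun h => by rw [h, norm_zero] at ln; linarith
  have hSm : Sxi m w ≠ 0 := fun h => by rw [h, norm_zero] at lm; linarith
  rw [inv_sub_inv hSm hSn, norm_div, norm_mul]
  have num := norm_Sxi_sub_Sxi_le (show 1 ≤ n by omega) hnm w
  rw [norm_sub_rev] at num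
  -- `‖w‖ ≤ (π+2) n`
  have hwn : ‖w‖ ≤ (Real.pi + 2) * n := by
    have h1 := Complex.norm_le_abs_re_add_abs_im w
    have h2 := Real.pi_lt_d2
    have h3 : (Real.pi + 2) * n = Real.pi * n + 2 * n := by ring
    rw [h3]; linarith
  have hexp : Real.exp (‖w‖ / n) ≤ Real.exp (Real.pi + 2) := by
    rw [Real.exp_le_exp, div_le_iff₀ hnpos]; exact hwn
  have hden : (‖w‖ ^ 2 / 32) * (‖w‖ ^ 2 / 32) ≤ ‖Sxi m w‖ * ‖Sxi n w‖ :=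
    mul_le_mul lm ln (by positivity) (norm_nonneg _)
  have hden0 : 0 < (‖w‖ ^ 2 / 32) * (‖w‖ ^ 2 / 32) := by positivity
  calc ‖Sxi n w - Sxi m w‖ / (‖Sxi m w‖ * ‖Sxi n w‖)
      ≤ (4 * ‖w‖ ^ 4 * Real.exp (‖w‖ / n) / (n : ℝ) ^ 2) / ((‖w‖ ^ 2 / 32) * (‖w‖ ^ 2 / 32)) := by
        rw [norm_sub_rev]
        exact div_le_div₀ (by positivity) (by rw [norm_sub_rev]; exact num) hden0 hden
    _ = 4096 * Real.exp (‖w‖ / n) / (n : ℝ) ^ 2 := by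
        field_simp
        ring
    _ ≤ Cinv / (n : ℝ) ^ 2 := by
        unfold Cinv
        gcongr

/-- `2πn`-periodicity of `S_ξ^{(n)}`. [folklore] -/
theorem Sxi_add_two_pi_mul (n : ℕ) (hn : n ≠ 0) (z : ℂ) :
    Sxi n (z + 2 * Real.pi * (n : ℂ)) = Sxi n z := by
  have hn' : (n : ℂ) ≠ 0 := Nat.cast_ne_zero.mpr hn
  unfold Sxi
  have : (z + 2 * Real.pi * (n : ℂ)) / n = z / n + 2 * Real.pi := by field_simp
  rw [this, Complex.cos_add_two_pi]

/-- `2πn`-periodicity of `S_ξ^{(n)}` (downward shift). [folklore] -/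
theorem Sxi_sub_two_pi_mul (n : ℕ) (hn : n ≠ 0) (z : ℂ) :
    Sxi n (z - 2 * Real.pi * (n : ℂ)) = Sxi n z := by
  have h := Sxi_add_two_pi_mul n hn (z - 2 * Real.pi * (n : ℂ))
  rw [sub_add_cancel] at h
  exact h.symm

/-! ### The centred alias pairing `ι : ℤ_n ↪ ℤ_m` and the recentred variable -/

/-- the centred pairing of alias indices: `ι(j) = j` for `2j < n`, `ι(j) = j + (m − n)` otherwise. [folklore] -/
def iota (n m j : ℕ) : ℕ := if 2 * j < n then j else j + (m - n)

/-- the recentred shifted variable: `z + 2πj` for `2j < n`, `z + 2πj − 2πn` otherwise. [folklore] -/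
def wc (n j : ℕ) (z : ℂ) : ℂ :=
  if 2 * j < n then z + 2 * Real.pi * (j : ℂ) else z + 2 * Real.pi * (j : ℂ) - 2 * Real.pi * (n : ℂ)

/-- "paired" alias indices of level `m`: the range of `ι`. [folklore] -/
def Paired (n m j' : ℕ) : Prop := 2 * j' < n ∨ 2 * m ≤ 2 * j' + n

/-- the inverse pairing on the paired indices. [folklore] -/
def iotaInv (n m j' : ℕ) : ℕ := if 2 * j' < n then j' else j' - (m - n)

/-- the pairing lands in `ℤ_m`: `ι(j) < m` for `j < n ≤ m`. [folklore] -/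
theorem iota_lt {n m j : ℕ} (hj : j < n) (hnm : n ≤ m) : iota n m j < m := by
  unfold iota; split_ifs <;> omega

/-- `ι(0) = 0` (`n ≥ 1`). [folklore] -/
theorem iota_zero {n m : ℕ} (hn : 1 ≤ n) : iota n m 0 = 0 := by
  unfold iota; rw [if_pos (by omega)]

/-- `ι(j) = 0 ↔ j = 0` (`n ≥ 1`). [folklore] -/
theorem iota_eq_zero_iff {n m j : ℕ} (hn : 1 ≤ n) : iota n m j = 0 ↔ j = 0 := by
  unfold iota; split_ifs <;> omega

/-- the pairing `ι` is injective. [folklore] -/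
theorem iota_injective {n m j₁ j₂ : ℕ} (h : iota n m j₁ = iota n m j₂) : j₁ = j₂ := by
  unfold iota at h; split_ifs at h <;> omega

/-- every `ι(j)` is a paired alias of level `m`. [folklore] -/
theorem paired_iota {n m j : ℕ} (hnm : n ≤ m) : Paired n m (iota n m j) := by
  unfold Paired iota; split_ifs <;> omega

/-- `ι ∘ ι⁻¹ = id` on the paired aliases of level `m`, and `ι⁻¹` lands in `ℤ_n`. [folklore] -/
theorem iota_iotaInv {n m j' : ℕ} (hp : Paired n m j') (hj' : j' < m) (hnm : n ≤ m) :
    iota n m (iotaInv n m j') = j' ∧ iotaInv n m j' < n := by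
  unfold Paired at hp; unfold iota iotaInv
  split_ifs <;> omega

/-- the level-`m` symbol at the paired alias equals the level-`m` symbol of the recentred variable. [folklore] -/
theorem Sxi_shift_iota (n m j : ℕ) (hm : m ≠ 0) (hnm : n ≤ m) (z : ℂ) :
    Sxi m (z + 2 * Real.pi * ((iota n m j : ℕ) : ℂ)) = Sxi m (wc n j z) := by
  unfold iota wc
  split_ifs with h
  · rfl
  · rw [← Sxi_sub_two_pi_mul m hm]
    congr 1
    push_cast [Nat.cast_sub hnm]
    ring

/-- the level-`n` symbol at the alias `j` equals the level-`n` symbol of the recentred variable. [folklore] -/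
theorem Sxi_shift_wc (n j : ℕ) (hn : n ≠ 0) (z : ℂ) :
    Sxi n (z + 2 * Real.pi * (j : ℂ)) = Sxi n (wc n j z) := by
  unfold wc
  split_ifs with h
  · rfl
  · rw [← Sxi_sub_two_pi_mul n hn (z + 2 * Real.pi * (j : ℂ))]

/-- recentring does not move the imaginary part. [folklore] -/
theorem wc_im (n j : ℕ) (z : ℂ) : (wc n j z).im = z.im := by
  unfold wc; split_ifs <;> simp

/-- the real part of the recentred variable. [folklore] -/
theorem wc_re (n j : ℕ) (z : ℂ) :
    (wc n j z).re = if 2 * j < n then z.re + 2 * Real.pi * j else z.re + 2 * Real.pi * j - 2 * Real.pi * n := by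
  unfold wc; split_ifs <;> simp

/-- the recentred variable stays in the extended range `|Re| ≤ πn + π + 1/4`. [folklore] -/
theorem abs_wc_re_le {n j : ℕ} (hj : j < n) {z : ℂ} (hx : |z.re| ≤ Real.pi + 1 / 4) :
    |(wc n j z).re| ≤ Real.pi * n + Real.pi + 1 / 4 := by
  have hπ := Real.pi_pos
  have hx' := abs_le.mp hx
  have hjn : (j : ℝ) + 1 ≤ n := by exact_mod_cast hj
  rw [wc_re, abs_le]
  split_ifs with h
  · have h2 : 2 * (j : ℝ) + 1 ≤ n := by exact_mod_cast (show 2 * j + 1 ≤ n by omega)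
    constructor <;> nlinarith
  · have h2 : (n : ℝ) ≤ 2 * j := by exact_mod_cast (show n ≤ 2 * j by omega)
    constructor <;> nlinarith

/-- for `j ≠ 0` the recentred variable is bounded away from `0`: `|Re wc| ≥ π − 1/4`. [folklore] -/
theorem wc_ne_zero {n j : ℕ} (hj0 : j ≠ 0) (hj : j < n) {z : ℂ} (hx : |z.re| ≤ Real.pi + 1 / 4) :
    wc n j z ≠ 0 := by
  intro h
  have hre := congrArg Complex.re h
  rw [wc_re, Complex.zero_re] at hre
  have hπ := Real.pi_gt_three
  have hx' := abs_le.mp hx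
  have hj1 : (1 : ℝ) ≤ j := by exact_mod_cast Nat.one_le_iff_ne_zero.mpr hj0
  split_ifs at hre with h2
  · nlinarith
  · have hnj : (1 : ℝ) ≤ n - j := by
      have : j + 1 ≤ n := hj
      have := (show ((j : ℝ) + 1 ≤ n) by exact_mod_cast this)
      linarith
    nlinarith

/-- `‖wc n j z‖ ≤ 11·ω_n(j)` on the fat box. [folklore] -/
theorem norm_wc_le {n j : ℕ} (hj : j < n) {z : ℂ} (hx : |z.re| ≤ Real.pi + 1 / 4) (hy : |z.im| ≤ 1 / 2) :
    ‖wc n j z‖ ≤ 11 * omega n j := by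
  have hπlo := Real.pi_gt_three
  have hπhi := Real.pi_lt_d2
  have hx' := abs_le.mp hx
  have hω1 := one_le_omega n j hj
  have h := Complex.norm_le_abs_re_add_abs_im (wc n j z)
  rw [wc_im] at h
  have hre : |(wc n j z).re| ≤ Real.pi + 1 / 4 + 2 * Real.pi * omega n j := by
    rw [wc_re]
    unfold omega
    split_ifs with h2
    · have h2r : 2 * (j : ℝ) + 1 ≤ n := by exact_mod_cast (show 2 * j + 1 ≤ n by omega)
      have hmin : min ((j : ℝ) + 1) ((n : ℝ) - j) = (j : ℝ) + 1 := min_eq_left (by linarith)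
      rw [hmin, abs_le]; constructor <;> nlinarith
    · have h2r : (n : ℝ) ≤ 2 * j := by exact_mod_cast (show n ≤ 2 * j by omega)
      have hjn : (j : ℝ) + 1 ≤ n := by exact_mod_cast hj
      have hmin : min ((j : ℝ) + 1) ((n : ℝ) - j) = (n : ℝ) - j := min_eq_right (by linarith)
      rw [hmin, abs_le]; constructor <;> nlinarith
  nlinarith

/-- the pairing does not decrease the distance to `0 mod` the period: `ω_n(j) ≤ ω_m(ι j)`. [folklore] -/
theorem omega_le_omega_iota {n m : ℕ} (j : ℕ) (hnm : n ≤ m) : omega n j ≤ omega m (iota n m j) := by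
  unfold omega iota
  have hmr : (n : ℝ) ≤ m := by exact_mod_cast hnm
  split_ifs with h
  · exact min_le_min le_rfl (by linarith)
  · push_cast [Nat.cast_sub hnm]
    refine le_min ?_ ?_
    · exact (min_le_left _ _).trans (by linarith)
    · exact (min_le_right _ _).trans (by linarith)

/-- an UNPAIRED alias of level `m` is far from `0`: `n ≤ 2 ω_m(j′)`. [folklore] -/
theorem le_two_omega_of_not_paired {n m j' : ℕ} (hp : ¬ Paired n m j') :
    (n : ℝ) ≤ 2 * omega m j' := by
  unfold Paired at hp
  push Not at hp
  have h1 : (n : ℝ) ≤ 2 * j' := by exact_mod_cast hp.1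
  have h2 : 2 * (j' : ℝ) + n + 1 ≤ 2 * m := by exact_mod_cast (show 2 * j' + n + 1 ≤ 2 * m by omega)
  unfold omega
  rcases min_choice ((j' : ℝ) + 1) ((m : ℝ) - j') with h | h <;> rw [h] <;> linarith

/-! ### The one-coordinate factors `uFactor` -/

/-- uniform alias bound `‖u_n(j; z)‖ ≤ 64/ω_n(j)²` (also at `j = 0`). [folklore] -/
theorem norm_uFactor_le_omega (n : ℕ) (hn : 1 ≤ n) {j : ℕ} (hj : j < n) {z : ℂ}
    (hx : |z.re| ≤ Real.pi + 1 / 4) (hy : |z.im| ≤ 1 / 2) :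
    ‖uFactor n j z‖ ≤ 64 / omega n j ^ 2 := by
  have hy' : |z.im| ≤ 2 * (1 / 4 : ℝ) := by linarith
  by_cases hj0 : j = 0
  · subst hj0
    rw [omega_zero n hn]
    have := norm_uFactor_zero_le n hn (le_refl (1 / 4 : ℝ)) hx hy'
    linarith
  · have h1 := norm_uFactor_ne_le n j (Nat.one_le_iff_ne_zero.mpr hj0) hj (le_refl (1 / 4 : ℝ)) hx hy'
    exact h1.trans (inv_sq_le_omega n j hj)

/-- the same bound for the level-`m` factor at the PAIRED alias, in terms of `ω_n(j)`. [folklore] -/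
theorem norm_uFactor_iota_le {n m : ℕ} (hn : 1 ≤ n) (hnm : n ≤ m) {j : ℕ} (hj : j < n) {z : ℂ}
    (hx : |z.re| ≤ Real.pi + 1 / 4) (hy : |z.im| ≤ 1 / 2) :
    ‖uFactor m (iota n m j) z‖ ≤ 64 / omega n j ^ 2 := by
  have hm : 1 ≤ m := hn.trans hnm
  have h1 := norm_uFactor_le_omega m hm (iota_lt hj hnm) (z := z) hx hy
  refine h1.trans ?_
  have hω := omega_pos n j hj
  exact div_le_div_of_nonneg_left (by norm_num) (by positivity)
    (pow_le_pow_left₀ hω.le (omega_le_omega_iota j hnm) 2)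

/-- **THE ONE-COORDINATE RATE**: `‖u_m(ι j; z) − u_n(j; z)‖ ≤ 16·Cinv/n²` for `2 ≤ n ≤ m`, `j < n`, on the fat box —
ABSOLUTE, uniform in the alias index. [folklore] -/
theorem norm_uFactor_iota_sub_le {n m : ℕ} (hn : 2 ≤ n) (hnm : n ≤ m) {j : ℕ} (hj : j < n) {z : ℂ}
    (hx : |z.re| ≤ Real.pi + 1 / 4) (hy : |z.im| ≤ 1 / 2) :
    ‖uFactor m (iota n m j) z - uFactor n j z‖ ≤ 16 * Cinv / (n : ℝ) ^ 2 := by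
  have hn1 : 1 ≤ n := by omega
  have hm0 : m ≠ 0 := by omega
  have hn0 : n ≠ 0 := by omega
  have hnr : (2 : ℝ) ≤ n := by exact_mod_cast hn
  have hy' : |z.im| ≤ 2 * (1 / 4 : ℝ) := by linarith
  have hS1 : ‖S1 z‖ ≤ 16 := norm_S1_le_16 (le_refl (1 / 4 : ℝ)) hx hy'
  have hC := Cinv_pos
  by_cases hj0 : j = 0
  · subst hj0
    rw [iota_zero hn1, uFactor_zero_eq, uFactor_zero_eq]
    split_ifs with hz
    · simp; positivity
    · have hxz : |z.re| ≤ Real.pi * n + Real.pi + 1 / 4 := by nlinarith [Real.pi_pos]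
      have h := norm_inv_Sxi_sub_le hn hnm hz hxz hy
      rw [div_eq_mul_inv, div_eq_mul_inv, ← mul_sub, norm_mul]
      calc ‖S1 z‖ * ‖(Sxi m z)⁻¹ - (Sxi n z)⁻¹‖ ≤ 16 * (Cinv / (n : ℝ) ^ 2) :=
            mul_le_mul hS1 h (norm_nonneg _) (by norm_num)
        _ = 16 * Cinv / (n : ℝ) ^ 2 := by ring
  · have hι0 : iota n m j ≠ 0 := fun h => hj0 ((iota_eq_zero_iff hn1).mp h)
    rw [uFactor_ne_eq n j hj0, uFactor_ne_eq m _ hι0, Sxi_shift_iota n m j hm0 hnm, Sxi_shift_wc n j hn0]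
    have hw0 := wc_ne_zero hj0 hj hx
    have hwx := abs_wc_re_le hj hx (z := z)
    have hwy : |(wc n j z).im| ≤ 1 / 2 := by rw [wc_im]; exact hy
    have h := norm_inv_Sxi_sub_le hn hnm hw0 hwx hwy
    rw [div_eq_mul_inv, div_eq_mul_inv, ← mul_sub, norm_mul]
    calc ‖S1 z‖ * _ ≤ 16 * (Cinv / (n : ℝ) ^ 2) := mul_le_mul hS1 h (norm_nonneg _) (by norm_num)
      _ = 16 * Cinv / (n : ℝ) ^ 2 := by ring

/-! ## §2  Assembly of the multiplier rate

Throughout, the fat-box data `(r, hr, hdr, hp)` are b05's (`B4StripCauchy.Fat`), and `2 ≤ n ≤ m` are the two levels. -/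

/-- on the fat box with `r ≤ 1/4`: `|Re p_ν| ≤ π + 1/4`. [folklore] -/
theorem fat_re {r : ℝ} (hr : r ≤ 1 / 4) {p : Fin d → ℂ} (hp : p ∈ Fat d r) (ν : Fin d) :
    |(p ν).re| ≤ Real.pi + 1 / 4 := by have := (hp ν).1; linarith

/-- on the fat box with `r ≤ 1/4`: `|Im p_ν| ≤ 1/2`. [folklore] -/
theorem fat_im {r : ℝ} (hr : r ≤ 1 / 4) {p : Fin d → ℂ} (hp : p ∈ Fat d r) (ν : Fin d) :
    |(p ν).im| ≤ 1 / 2 := by have := (hp ν).2; linarith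

/-- the one-coordinate rate `ρ_n = 16·Cinv/n²`. [folklore] -/
def rho (n : ℕ) : ℝ := 16 * Cinv / (n : ℝ) ^ 2

/-- `0 ≤ ρ(n)`. [folklore] -/
theorem rho_nonneg (n : ℕ) : 0 ≤ rho n := by unfold rho; have := Cinv_pos; positivity

/-- rate-and-bound package of one paired `u`-factor: bound `64/ω_n(j)²`, rate `ρ(n)`. [folklore] -/
theorem uFactor_RB {n m : ℕ} (hn : 2 ≤ n) (hnm : n ≤ m) {j : ℕ} (hj : j < n) {z : ℂ}
    (hx : |z.re| ≤ Real.pi + 1 / 4) (hy : |z.im| ≤ 1 / 2) :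
    RB (uFactor m (iota n m j) z) (uFactor n j z) (64 / omega n j ^ 2) (rho n) :=
  ⟨norm_uFactor_iota_le (by omega) hnm hj hx hy, norm_uFactor_le_omega n (by omega) hj hx hy,
    norm_uFactor_iota_sub_le hn hnm hj hx hy⟩

/-- rate-and-bound package of the zero-alias `u`-factor: bound `4`, rate `ρ(n)`. [folklore] -/
theorem uFactor_zero_RB {n m : ℕ} (hn : 2 ≤ n) (hnm : n ≤ m) {z : ℂ}
    (hx : |z.re| ≤ Real.pi + 1 / 4) (hy : |z.im| ≤ 1 / 2) :
    RB (uFactor m 0 z) (uFactor n 0 z) 4 (rho n) := by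
  have hy' : |z.im| ≤ 2 * (1 / 4 : ℝ) := by linarith
  refine ⟨norm_uFactor_zero_le m (by omega) le_rfl hx hy', norm_uFactor_zero_le n (by omega) le_rfl hx hy', ?_⟩
  have h := norm_uFactor_iota_sub_le hn hnm (j := 0) (by omega) hx hy
  rwa [iota_zero (by omega : 1 ≤ n)] at h

/-! ### The paired multi-index and the recentred shifted Laplacian -/

/-- the centred pairing on multi-indices. [folklore] -/
def iotaK (n m : ℕ) (hnm : n ≤ m) (k : Fin d → Fin n) : Fin d → Fin m :=
  fun ν => ⟨iota n m (k ν), iota_lt (k ν).isLt hnm⟩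

/-- the components of `ι_K(k)` are `ι(k_ν)`. [folklore] -/
@[simp] theorem iotaK_val {n m : ℕ} (hnm : n ≤ m) (k : Fin d → Fin n) (ν : Fin d) :
    ((iotaK n m hnm k ν : Fin m) : ℕ) = iota n m (k ν) := rfl

/-- the multi-index pairing `ι_K` preserves non-zero multi-indices. [folklore] -/
theorem iotaK_ne_zero {n m : ℕ} [NeZero n] [NeZero m] (hnm : n ≤ m) {k : Fin d → Fin n}
    (hk : k ≠ fun _ => 0) : iotaK n m hnm k ≠ fun _ => 0 := by
  intro h
  apply hk
  funext ν
  have h1 := congrArg Fin.val (congrFun h ν)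
  have h2 : iota n m (k ν) = 0 := by simpa using h1
  exact Fin.ext (by
    rw [Fin.val_zero]
    exact (iota_eq_zero_iff (Nat.one_le_iff_ne_zero.mpr (NeZero.ne n))).mp h2)

/-- the multi-index pairing `ι_K` is injective. [folklore] -/
theorem iotaK_injective {n m : ℕ} (hnm : n ≤ m) : Function.Injective (iotaK (d := d) n m hnm) := by
  intro k₁ k₂ h
  funext ν
  have h1 := congrArg Fin.val (congrFun h ν)
  simp only [iotaK_val] at h1
  exact Fin.ext (iota_injective h1)

/-- the shifted inverse-Laplacian symbol written in the recentred variables: `Σ_μ S_ξ^{(N)}(wc n k_μ p_μ)`. [folklore] -/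
def SW (N n : ℕ) (k : Fin d → Fin n) (p : Fin d → ℂ) : ℂ := ∑ μ, Sxi N (wc n (k μ) (p μ))

/-- the shifted Laplacian symbol of level `n` at alias `k` is `SW n n k`. [folklore] -/
theorem DeltaXi_shift_eq_SW (n : ℕ) [NeZero n] (k : Fin d → Fin n) (p : Fin d → ℂ) :
    DeltaXi n 0 (shift n k p) = SW n n k p := by
  unfold DeltaXi shift SW
  simp only [Complex.ofReal_zero, add_zero]
  exact Finset.sum_congr rfl (fun μ _ => Sxi_shift_wc n (k μ) (NeZero.ne n) (p μ))

/-- the shifted Laplacian symbol of level `m` at the paired alias `ι_K(k)` is `SW m n k` (periodicity of `S_ξ^{(m)}`). [folklore] -/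
theorem DeltaXi_shift_iotaK_eq_SW {n m : ℕ} [NeZero m] (hnm : n ≤ m) (k : Fin d → Fin n) (p : Fin d → ℂ) :
    DeltaXi m 0 (shift m (iotaK n m hnm k) p) = SW m n k p := by
  unfold DeltaXi shift SW
  simp only [Complex.ofReal_zero, add_zero, iotaK_val]
  exact Finset.sum_congr rfl (fun μ _ => Sxi_shift_iota n m (k μ) (NeZero.ne m) hnm (p μ))

/-- the pairing does not decrease King's weight: `W_n(k) ≤ W_m(ι k)`. [folklore] -/
theorem W_le_W_iotaK {n m : ℕ} [NeZero n] [NeZero m] (hnm : n ≤ m) (k : Fin d → Fin n) :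
    W n k ≤ W m (iotaK n m hnm k) := by
  unfold W
  refine Finset.sum_le_sum (fun ν _ => ?_)
  have hn1 : 1 ≤ n := Nat.one_le_iff_ne_zero.mpr (NeZero.ne n)
  simp only [iotaK_val]
  by_cases h0 : (k ν : ℕ) = 0
  · rw [if_pos h0, if_pos (by rw [h0]; exact iota_zero hn1)]
  · rw [if_neg h0, if_neg (fun h => h0 ((iota_eq_zero_iff hn1).mp h))]
    exact pow_le_pow_left₀ (omega_pos n _ (k ν).isLt).le (omega_le_omega_iota _ hnm) 2

/-- lower bound `(7/64)·W_n(k) ≤ ‖SW n n k p‖` on the fat box (`B4StripSums.re_DeltaXi_shift_ge_W`). [folklore] -/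
theorem norm_SW_ge (n : ℕ) [NeZero n] {r : ℝ} (hr : r ≤ 1 / 4) (hdr : (d : ℝ) * r ^ 2 ≤ 1 / 16)
    {p : Fin d → ℂ} (hp : p ∈ Fat d r) {k : Fin d → Fin n} (hk : k ≠ fun _ => 0) :
    7 / 64 * W n k ≤ ‖SW n n k p‖ := by
  rw [← DeltaXi_shift_eq_SW]
  exact (re_DeltaXi_shift_ge_W n 0 le_rfl hr hdr hp k hk).trans (Complex.re_le_norm _)

/-- the same lower bound for the level-`m` symbol at the paired alias: `(7/64)·W_n(k) ≤ ‖SW m n k p‖`. [folklore] -/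
theorem norm_SWm_ge {n m : ℕ} [NeZero n] [NeZero m] (hnm : n ≤ m) {r : ℝ} (hr : r ≤ 1 / 4)
    (hdr : (d : ℝ) * r ^ 2 ≤ 1 / 16) {p : Fin d → ℂ} (hp : p ∈ Fat d r) {k : Fin d → Fin n}
    (hk : k ≠ fun _ => 0) : 7 / 64 * W n k ≤ ‖SW m n k p‖ := by
  rw [← DeltaXi_shift_iotaK_eq_SW hnm]
  have h1 := re_DeltaXi_shift_ge_W m 0 le_rfl hr hdr hp (iotaK n m hnm k) (iotaK_ne_zero hnm hk)
  have h2 := W_le_W_iotaK hnm k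
  exact le_trans (by linarith) (h1.trans (Complex.re_le_norm _))

/-- inversion of a lower bound: `(7/64)·W ≤ ‖z‖`, `W ≥ 1` ⟹ `‖z⁻¹‖ ≤ (64/7)/W`. [folklore] -/
theorem inv_le_of_W {z : ℂ} {Wk : ℝ} (hW : 1 ≤ Wk) (h : 7 / 64 * Wk ≤ ‖z‖) : ‖z⁻¹‖ ≤ 64 / 7 / Wk := by
  have hpos : 0 < 7 / 64 * Wk := by positivity
  rw [norm_inv]
  calc ‖z‖⁻¹ ≤ (7 / 64 * Wk)⁻¹ := inv_anti₀ hpos h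
    _ = 64 / 7 / Wk := by rw [mul_inv, inv_div]; ring

/-- `‖(SW n n k p)⁻¹‖ ≤ (64/7)/W_n(k)`. [folklore] -/
theorem norm_inv_SW_le (n : ℕ) [NeZero n] {r : ℝ} (hr : r ≤ 1 / 4) (hdr : (d : ℝ) * r ^ 2 ≤ 1 / 16)
    {p : Fin d → ℂ} (hp : p ∈ Fat d r) {k : Fin d → Fin n} (hk : k ≠ fun _ => 0) :
    ‖(SW n n k p)⁻¹‖ ≤ 64 / 7 / W n k :=
  inv_le_of_W (one_le_W n k hk) (norm_SW_ge n hr hdr hp hk)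

/-- `‖(SW m n k p)⁻¹‖ ≤ (64/7)/W_n(k)`. [folklore] -/
theorem norm_inv_SWm_le {n m : ℕ} [NeZero n] [NeZero m] (hnm : n ≤ m) {r : ℝ} (hr : r ≤ 1 / 4)
    (hdr : (d : ℝ) * r ^ 2 ≤ 1 / 16) {p : Fin d → ℂ} (hp : p ∈ Fat d r) {k : Fin d → Fin n}
    (hk : k ≠ fun _ => 0) : ‖(SW m n k p)⁻¹‖ ≤ 64 / 7 / W n k :=
  inv_le_of_W (one_le_W n k hk) (norm_SWm_ge hnm hr hdr hp hk)

/-- the recentred shifted Laplacian converges at rate `W_n(k)²/n²`. [folklore] -/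
theorem norm_SW_sub_le {n m : ℕ} [NeZero n] [NeZero m] (hn : 2 ≤ n) (hnm : n ≤ m) {r : ℝ} (hr : r ≤ 1 / 4)
    {p : Fin d → ℂ} (hp : p ∈ Fat d r) {k : Fin d → Fin n} (hk : k ≠ fun _ => 0) :
    ‖SW m n k p - SW n n k p‖
      ≤ d * (4 * 11 ^ 4 * Real.exp (Real.pi + 2)) * W n k ^ 2 / (n : ℝ) ^ 2 := by
  have hnr : (2 : ℝ) ≤ n := by exact_mod_cast hn
  have hnpos : (0 : ℝ) < n := by linarith
  have hterm : ∀ μ : Fin d, ‖Sxi m (wc n (k μ) (p μ)) - Sxi n (wc n (k μ) (p μ))‖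
      ≤ 4 * 11 ^ 4 * Real.exp (Real.pi + 2) * W n k ^ 2 / (n : ℝ) ^ 2 := by
    intro μ
    have h1 := norm_Sxi_sub_Sxi_le (n := n) (m := m) (by omega) hnm (wc n (k μ) (p μ))
    have hwn : ‖wc n (k μ) (p μ)‖ ≤ 11 * omega n (k μ) :=
      norm_wc_le (k μ).isLt (fat_re hr hp μ) (fat_im hr hp μ)
    have hω2 : omega n (k μ) ^ 2 ≤ W n k := omega_sq_le_W n k hk μ
    have hω0 : 0 ≤ omega n (k μ) := (omega_pos n _ (k μ).isLt).le
    have hw4 : ‖wc n (k μ) (p μ)‖ ^ 4 ≤ 11 ^ 4 * W n k ^ 2 := by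
      calc ‖wc n (k μ) (p μ)‖ ^ 4 ≤ (11 * omega n (k μ)) ^ 4 := pow_le_pow_left₀ (norm_nonneg _) hwn 4
        _ = 11 ^ 4 * (omega n (k μ) ^ 2) ^ 2 := by ring
        _ ≤ 11 ^ 4 * W n k ^ 2 := by gcongr
    have hexp : Real.exp (‖wc n (k μ) (p μ)‖ / n) ≤ Real.exp (Real.pi + 2) := by
      rw [Real.exp_le_exp, div_le_iff₀ hnpos]
      have e1 := Complex.norm_le_abs_re_add_abs_im (wc n (k μ) (p μ))
      have e2 := abs_wc_re_le (k μ).isLt (fat_re hr hp μ) (z := p μ)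
      have e3 : |(wc n (k μ) (p μ)).im| ≤ 1 / 2 := by rw [wc_im]; exact fat_im hr hp μ
      have e4 := Real.pi_lt_d2
      have e5 : (Real.pi + 2) * n = Real.pi * n + 2 * n := by ring
      rw [e5]; linarith
    calc _ ≤ _ := h1
      _ ≤ 4 * (11 ^ 4 * W n k ^ 2) * Real.exp (Real.pi + 2) / (n : ℝ) ^ 2 := by gcongr
      _ = _ := by ring
  unfold SW
  rw [← Finset.sum_sub_distrib]
  calc ‖∑ μ, (Sxi m (wc n (k μ) (p μ)) - Sxi n (wc n (k μ) (p μ)))‖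
      ≤ ∑ μ, ‖Sxi m (wc n (k μ) (p μ)) - Sxi n (wc n (k μ) (p μ))‖ := norm_sum_le _ _
    _ ≤ ∑ _μ : Fin d, 4 * 11 ^ 4 * Real.exp (Real.pi + 2) * W n k ^ 2 / (n : ℝ) ^ 2 :=
        Finset.sum_le_sum (fun μ _ => hterm μ)
    _ = _ := by rw [Finset.sum_const, Finset.card_univ, Fintype.card_fin, nsmul_eq_mul]; ring

/-- the constant of the shifted-inverse-Laplacian rate. [folklore] -/
def CD (d : ℕ) : ℝ := d * (4 * 11 ^ 4 * Real.exp (Real.pi + 2)) * (64 / 7) ^ 2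

/-- `0 ≤ CD(d)`. [folklore] -/
theorem CD_nonneg (d : ℕ) : 0 ≤ CD d := by unfold CD; positivity

/-- **rate of the shifted inverse Laplacian under the pairing**: `‖SW_m⁻¹ − SW_n⁻¹‖ ≤ CD(d)/n²` — the `W²` of the
numerator cancels against the two `(7/64)·W` lower bounds. [folklore] -/
theorem norm_inv_SW_sub_le {n m : ℕ} [NeZero n] [NeZero m] (hn : 2 ≤ n) (hnm : n ≤ m) {r : ℝ}
    (hr : r ≤ 1 / 4) (hdr : (d : ℝ) * r ^ 2 ≤ 1 / 16) {p : Fin d → ℂ} (hp : p ∈ Fat d r)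
    {k : Fin d → Fin n} (hk : k ≠ fun _ => 0) :
    ‖(SW m n k p)⁻¹ - (SW n n k p)⁻¹‖ ≤ CD d / (n : ℝ) ^ 2 := by
  have hW := one_le_W n k hk
  have hA := norm_SWm_ge hnm hr hdr hp hk
  have hB := norm_SW_ge n hr hdr hp hk
  have hpos : 0 < 7 / 64 * W n k := by positivity
  have hA0 : SW m n k p ≠ 0 := fun h => by rw [h, norm_zero] at hA; linarith
  have hB0 : SW n n k p ≠ 0 := fun h => by rw [h, norm_zero] at hB; linarith
  have hnr : (2 : ℝ) ≤ n := by exact_mod_cast hn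
  have hn0 : (n : ℝ) ≠ 0 := by positivity
  have hW0 : W n k ≠ 0 := by positivity
  rw [inv_sub_inv hA0 hB0, norm_div, norm_mul, norm_sub_rev]
  have num := norm_SW_sub_le hn hnm hr hp hk
  calc ‖SW m n k p - SW n n k p‖ / (‖SW m n k p‖ * ‖SW n n k p‖)
      ≤ (d * (4 * 11 ^ 4 * Real.exp (Real.pi + 2)) * W n k ^ 2 / (n : ℝ) ^ 2)
          / ((7 / 64 * W n k) * (7 / 64 * W n k)) :=
        div_le_div₀ (by positivity) num (by positivity) (mul_le_mul hA hB hpos.le (norm_nonneg _))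
    _ = CD d / (n : ℝ) ^ 2 := by unfold CD; field_simp

/-! ### The summands of `R̃` -/

/-- the `k`-summand of `R̃_λ` at level `N`. [folklore] -/
def T166 (N : ℕ) [NeZero N] (lam : Fin d) (k : Fin d → Fin N) (p : Fin d → ℂ) : ℂ :=
  U N k p * uFactor N (k lam : ℕ) (p lam) / DeltaXi N 0 (shift N k p)

/-- `R̃` as the sum of the summands `T166` over the non-zero aliases (definitional). [folklore] -/
theorem Rt_eq_sum (N : ℕ) [NeZero N] (lam : Fin d) (p : Fin d → ℂ) :
    Rt N lam p = ∑ k ∈ univ.erase (fun _ => (0 : Fin N)), T166 N lam k p := rfl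

/-- the summable alias majorant `Π_ν 64/ω_n(k_ν)²`. [folklore] -/
def cω (n : ℕ) (k : Fin d → Fin n) : ℝ := ∏ ν, 64 / omega n (k ν) ^ 2

/-- `0 < cω_n(k)`. [folklore] -/
theorem cω_pos {n : ℕ} (k : Fin d → Fin n) : 0 < cω n k := by
  unfold cω
  exact Finset.prod_pos (fun ν _ => by have := omega_pos n (k ν) (k ν).isLt; positivity)

/-- rate-and-bound package of `U` at paired aliases: bound `cω_n(k)`, rate `ρ(n)·cω_n(k)·Σ_ν ω_n(k_ν)²/64`. [folklore] -/
theorem U_RB {n m : ℕ} (hn : 2 ≤ n) (hnm : n ≤ m) {r : ℝ} (hr : r ≤ 1 / 4) {p : Fin d → ℂ}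
    (hp : p ∈ Fat d r) (k : Fin d → Fin n) :
    RB (U m (iotaK n m hnm k) p) (U n k p) (cω n k)
      (rho n * cω n k * ∑ ν, (64 / omega n (k ν) ^ 2)⁻¹) := by
  unfold U cω
  exact RB.prod_inv (Finset.univ : Finset (Fin d))
    (f := fun ν => uFactor m (iotaK n m hnm k ν : ℕ) (p ν)) (g := fun ν => uFactor n (k ν : ℕ) (p ν))
    (c := fun ν => 64 / omega n (k ν) ^ 2) (ρ := rho n)
    (fun ν _ => by have := omega_pos n (k ν) (k ν).isLt; positivity)
    (fun ν _ => by
      simpa only [iotaK_val] using uFactor_RB hn hnm (k ν).isLt (fat_re hr hp ν) (fat_im hr hp ν))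

/-- `Σ_ν ω_n(k_ν)² ≤ (d+1)·W_n(k)` (coordinates with `k_ν = 0` contribute `1 ≤ W`). [folklore] -/
theorem sum_inv_c_le {n : ℕ} [NeZero n] {k : Fin d → Fin n} (hk : k ≠ fun _ => 0) :
    64 * ∑ ν, (64 / omega n (k ν) ^ 2)⁻¹ ≤ ((d : ℝ) + 1) * W n k := by
  have hn1 : 1 ≤ n := Nat.one_le_iff_ne_zero.mpr (NeZero.ne n)
  have e : ∀ ν, (64 / omega n (k ν) ^ 2)⁻¹ = omega n (k ν) ^ 2 / 64 := fun ν => by rw [inv_div]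
  simp_rw [e]
  rw [← Finset.sum_div]
  have e2 : (64 : ℝ) * ((∑ ν, omega n (k ν) ^ 2) / 64) = ∑ ν, omega n (k ν) ^ 2 := by ring
  rw [e2]
  have hW := one_le_W n k hk
  have h1 : ∑ ν, omega n (k ν) ^ 2 ≤ W n k + d := by
    unfold W
    rw [show (d : ℝ) = ∑ _ν : Fin d, (1 : ℝ) by simp, ← Finset.sum_add_distrib]
    refine Finset.sum_le_sum (fun ν _ => ?_)
    split_ifs with h0
    · rw [h0, omega_zero n hn1]; norm_num
    · linarith
  have hd : (0 : ℝ) ≤ d := Nat.cast_nonneg d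
  nlinarith

/-- the constant of the paired-summand rate. [folklore] -/
def KT (d : ℕ) : ℝ := 64 * CD d + 16 * Cinv * (64 / 7) * ((d : ℝ) + 2)

/-- `0 ≤ KT(d)`. [folklore] -/
theorem KT_nonneg (d : ℕ) : 0 ≤ KT d := by
  unfold KT; have := CD_nonneg d; have := Cinv_pos; positivity

/-- the arithmetic of the summand rate (bookkeeping inequality). [folklore] -/
theorem rate_arith {X A T Wk CDn d' : ℝ} (hX : 0 ≤ X) (hA : 0 ≤ A) (hW : 1 ≤ Wk) (hT0 : 0 ≤ T)
    (hT : 64 * T ≤ d' * Wk) :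
    X * 64 * CDn + (X * A + A * X * T * 64) * (64 / 7 / Wk) ≤ X * (64 * CDn + A * (64 / 7) * (d' + 1)) := by
  have hWpos : 0 < Wk := by linarith
  have h1 : (1 + 64 * T) / Wk ≤ d' + 1 := by rw [div_le_iff₀ hWpos]; nlinarith
  have e : (X * A + A * X * T * 64) * (64 / 7 / Wk) = X * A * (64 / 7) * ((1 + 64 * T) / Wk) := by
    field_simp
  rw [e]
  have h2 : X * A * (64 / 7) * ((1 + 64 * T) / Wk) ≤ X * A * (64 / 7) * (d' + 1) :=
    mul_le_mul_of_nonneg_left h1 (by positivity)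
  nlinarith

/-- **RATE OF A PAIRED SUMMAND**: `‖T_m(ι k) − T_n(k)‖ ≤ KT(d)/n² · Π_ν 64/ω_n(k_ν)²` — the coordinate decay lost in
the one-coordinate absolute rate is recovered from the shifted inverse Laplacian (`1/Δ ≤ (64/7)/W ≤ (64/7)/ω_ν²`).
[folklore] -/
theorem T166_rate {n m : ℕ} [NeZero n] [NeZero m] (hn : 2 ≤ n) (hnm : n ≤ m) {r : ℝ} (hr : r ≤ 1 / 4)
    (hdr : (d : ℝ) * r ^ 2 ≤ 1 / 16) {p : Fin d → ℂ} (hp : p ∈ Fat d r) {k : Fin d → Fin n}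
    (hk : k ≠ fun _ => 0) (lam : Fin d) :
    ‖T166 m lam (iotaK n m hnm k) p - T166 n lam k p‖ ≤ KT d / (n : ℝ) ^ 2 * cω n k := by
  have hU := U_RB hn hnm hr hp k
  have hω1 : 1 ≤ omega n (k lam) ^ 2 := one_le_pow₀ (one_le_omega n _ (k lam).isLt)
  have hu : RB (uFactor m (iota n m (k lam)) (p lam)) (uFactor n (k lam) (p lam)) 64 (rho n) :=
    (uFactor_RB hn hnm (k lam).isLt (fat_re hr hp lam) (fat_im hr hp lam)).mono
      (div_le_self (by norm_num) hω1) le_rfl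
  have hD : RB ((SW m n k p)⁻¹) ((SW n n k p)⁻¹) (64 / 7 / W n k) (CD d / (n : ℝ) ^ 2) :=
    ⟨norm_inv_SWm_le hnm hr hdr hp hk, norm_inv_SW_le n hr hdr hp hk, norm_inv_SW_sub_le hn hnm hr hdr hp hk⟩
  have h := (hU.mul hu).mul hD
  have eTm : T166 m lam (iotaK n m hnm k) p
      = U m (iotaK n m hnm k) p * uFactor m (iota n m (k lam)) (p lam) * (SW m n k p)⁻¹ := by
    unfold T166; rw [div_eq_mul_inv, DeltaXi_shift_iotaK_eq_SW]; rfl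
  have eTn : T166 n lam k p = U n k p * uFactor n (k lam) (p lam) * (SW n n k p)⁻¹ := by
    unfold T166; rw [div_eq_mul_inv, DeltaXi_shift_eq_SW]
  rw [eTm, eTn]
  refine h.sub.trans ?_
  have hnr : (2 : ℝ) ≤ n := by exact_mod_cast hn
  have hT0 : 0 ≤ ∑ ν, (64 / omega n (k ν) ^ 2)⁻¹ :=
    Finset.sum_nonneg (fun ν _ => by have := omega_pos n (k ν) (k ν).isLt; positivity)
  have hra := rate_arith (X := cω n k) (A := rho n) (T := ∑ ν, (64 / omega n (k ν) ^ 2)⁻¹)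
    (Wk := W n k) (CDn := CD d / (n : ℝ) ^ 2) (d' := (d : ℝ) + 1) (cω_pos k).le (rho_nonneg n)
    (one_le_W n k hk) hT0 (sum_inv_c_le hk)
  refine hra.trans (le_of_eq ?_)
  unfold KT rho
  ring

/-- uniform bound of a summand through King's weight: `‖T_N(k)‖ ≤ cω_N(k)·64·(64/7)/W_N(k)`. [folklore] -/
theorem norm_T166_le (N : ℕ) [NeZero N] {r : ℝ} (hr : r ≤ 1 / 4) (hdr : (d : ℝ) * r ^ 2 ≤ 1 / 16)
    {p : Fin d → ℂ} (hp : p ∈ Fat d r) {k : Fin d → Fin N} (hk : k ≠ fun _ => 0) (lam : Fin d) :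
    ‖T166 N lam k p‖ ≤ cω N k * 64 * (64 / 7 / W N k) := by
  have hN : 1 ≤ N := Nat.one_le_iff_ne_zero.mpr (NeZero.ne N)
  have hΔ := (re_DeltaXi_shift_ge_W N 0 le_rfl hr hdr hp k hk).trans (Complex.re_le_norm _)
  have h1 : ∏ ν, ‖uFactor N (k ν : ℕ) (p ν)‖ ≤ cω N k := by
    unfold cω
    exact Finset.prod_le_prod (fun _ _ => norm_nonneg _)
      (fun ν _ => norm_uFactor_le_omega N hN (k ν).isLt (fat_re hr hp ν) (fat_im hr hp ν))
  have hω1 : 1 ≤ omega N (k lam) ^ 2 := one_le_pow₀ (one_le_omega N _ (k lam).isLt)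
  have h2 : ‖uFactor N (k lam : ℕ) (p lam)‖ ≤ 64 :=
    (norm_uFactor_le_omega N hN (k lam).isLt (fat_re hr hp lam) (fat_im hr hp lam)).trans
      (div_le_self (by norm_num) hω1)
  have h3 : ‖(DeltaXi N 0 (shift N k p))⁻¹‖ ≤ 64 / 7 / W N k := inv_le_of_W (one_le_W N k hk) hΔ
  unfold T166
  rw [div_eq_mul_inv, norm_mul, norm_mul, norm_U_eq]
  have hc := (cω_pos k).le
  exact mul_le_mul (mul_le_mul h1 h2 (norm_nonneg _) hc) h3 (norm_nonneg _) (by positivity)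

/-- an UNPAIRED summand of level `m` is `O(n⁻²)`: `‖T_m(k′)‖ ≤ (16384/7)/n² · cω_m(k′)`. [folklore] -/
theorem norm_T166_unpaired_le {n m : ℕ} [NeZero m] (hn : 1 ≤ n) {r : ℝ} (hr : r ≤ 1 / 4)
    (hdr : (d : ℝ) * r ^ 2 ≤ 1 / 16) {p : Fin d → ℂ} (hp : p ∈ Fat d r) {k' : Fin d → Fin m}
    (hk : k' ≠ fun _ => 0) (hP : ¬ ∀ ν, Paired n m (k' ν)) (lam : Fin d) :
    ‖T166 m lam k' p‖ ≤ 16384 / 7 / (n : ℝ) ^ 2 * cω m k' := by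
  obtain ⟨ν₀, hν₀⟩ := not_forall.mp hP
  have hω := le_two_omega_of_not_paired hν₀
  have hW := omega_sq_le_W m k' hk ν₀
  have hW1 := one_le_W m k' hk
  have h := norm_T166_le m hr hdr hp hk lam
  have hnr : (1 : ℝ) ≤ n := by exact_mod_cast hn
  have hn2 : (n : ℝ) ^ 2 ≤ 4 * W m k' := by nlinarith
  have h4 : 64 / 7 / W m k' ≤ 64 / 7 * (4 / (n : ℝ) ^ 2) := by
    rw [div_eq_mul_inv (64 / 7 : ℝ)]
    refine mul_le_mul_of_nonneg_left ?_ (by norm_num)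
    rw [inv_eq_one_div, div_le_div_iff₀ (by positivity) (by positivity)]
    linarith
  have hc := (cω_pos k').le
  calc ‖T166 m lam k' p‖ ≤ cω m k' * 64 * (64 / 7 / W m k') := h
    _ ≤ cω m k' * 64 * (64 / 7 * (4 / (n : ℝ) ^ 2)) := mul_le_mul_of_nonneg_left h4 (by positivity)
    _ = 16384 / 7 / (n : ℝ) ^ 2 * cω m k' := by ring

/-! ### Summability of the alias majorant -/

/-- `Σ_{j ∈ ℤ_N} 64/ω_N(j)² ≤ 256`. [folklore] -/
theorem sum_c_le (N : ℕ) : ∑ j : Fin N, 64 / omega N j ^ 2 ≤ 256 := by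
  have hterm : ∀ j : Fin N, 64 / omega N j ^ 2
      ≤ 64 * (1 / (((j : ℕ) : ℝ) + 1) ^ 2) + 64 * (1 / ((N : ℝ) - (j : ℕ)) ^ 2) := by
    intro j
    have hj : (j : ℕ) < N := j.isLt
    have hjr : ((j : ℕ) : ℝ) + 1 ≤ N := by exact_mod_cast hj
    have hA : 0 < ((j : ℕ) : ℝ) + 1 := by positivity
    have hB : 0 < (N : ℝ) - (j : ℕ) := by linarith
    have hpA : 0 ≤ 64 * (1 / (((j : ℕ) : ℝ) + 1) ^ 2) := by positivity
    have hpB : 0 ≤ 64 * (1 / ((N : ℝ) - (j : ℕ)) ^ 2) := by positivity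
    unfold omega
    rcases min_choice (((j : ℕ) : ℝ) + 1) ((N : ℝ) - (j : ℕ)) with h | h <;> rw [h]
    · rw [div_eq_mul_one_div]; linarith
    · rw [div_eq_mul_one_div]; linarith
  calc ∑ j : Fin N, 64 / omega N j ^ 2
      ≤ ∑ j : Fin N, (64 * (1 / (((j : ℕ) : ℝ) + 1) ^ 2) + 64 * (1 / ((N : ℝ) - (j : ℕ)) ^ 2)) :=
        Finset.sum_le_sum (fun j _ => hterm j)
    _ = 64 * ∑ j : Fin N, 1 / (((j : ℕ) : ℝ) + 1) ^ 2 + 64 * ∑ j : Fin N, 1 / ((N : ℝ) - (j : ℕ)) ^ 2 := by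
        rw [Finset.sum_add_distrib, Finset.mul_sum, Finset.mul_sum]
    _ ≤ 64 * 2 + 64 * 2 := by
        rw [sum_reflect_inv_sq]
        have := Beta.AliasRatioStrip.sum_inv_succ_sq_le_two N
        linarith
    _ = 256 := by norm_num

/-- `Σ_{k ∈ ℤ_N^d} Π_ν 64/ω_N(k_ν)² ≤ 256^d`. [folklore] -/
theorem sum_cω_le (N : ℕ) : ∑ k : Fin d → Fin N, cω N k ≤ 256 ^ d := by
  unfold cω
  have h := Finset.prod_univ_sum (fun _ : Fin d => (Finset.univ : Finset (Fin N)))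
    (fun _ν j => 64 / omega N (j : ℕ) ^ 2)
  rw [Fintype.piFinset_univ] at h
  rw [← h]
  calc ∏ _ν : Fin d, ∑ j : Fin N, 64 / omega N j ^ 2 ≤ ∏ _ν : Fin d, (256 : ℝ) :=
        Finset.prod_le_prod (fun _ _ => Finset.sum_nonneg (fun j _ => by
          have := omega_pos N j j.isLt; positivity)) (fun _ _ => sum_c_le N)
    _ = 256 ^ d := by simp

/-! ### The rate of `R̃` -/

/-- `Paired n m j'` is decidable. [folklore] -/
instance Paired.instDecidable (n m j' : ℕ) : Decidable (Paired n m j') := by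
  unfold Paired; infer_instance

/-- the paired level-`m` multi-indices are exactly the image of the pairing. [folklore] -/
theorem filter_paired_eq_image {n m : ℕ} [NeZero n] [NeZero m] (hnm : n ≤ m) :
    ((univ : Finset (Fin d → Fin m)).erase (fun _ => 0)).filter (fun k' => ∀ ν, Paired n m (k' ν))
      = ((univ : Finset (Fin d → Fin n)).erase (fun _ => 0)).image (iotaK n m hnm) := by
  have hn1 : 1 ≤ n := Nat.one_le_iff_ne_zero.mpr (NeZero.ne n)
  ext k'
  simp only [Finset.mem_filter, Finset.mem_erase, Finset.mem_univ, and_true, Finset.mem_image, ne_eq]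
  constructor
  · rintro ⟨hk0, hP⟩
    refine ⟨fun ν => ⟨iotaInv n m (k' ν), (iota_iotaInv (hP ν) (k' ν).isLt hnm).2⟩, ?_, ?_⟩
    · intro h
      apply hk0
      funext ν
      have h1 : iotaInv n m (k' ν) = 0 := by
        have := congrArg Fin.val (congrFun h ν)
        simpa using this
      have h2 := (iota_iotaInv (hP ν) (k' ν).isLt hnm).1
      rw [h1, iota_zero hn1] at h2
      exact Fin.ext (by rw [Fin.val_zero]; exact h2.symm)
    · funext ν
      exact Fin.ext (iota_iotaInv (hP ν) (k' ν).isLt hnm).1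
  · rintro ⟨k, hk0, rfl⟩
    exact ⟨iotaK_ne_zero hnm hk0, fun ν => paired_iota hnm⟩

/-- `R̃` at level `m` = (paired summands, re-indexed by level `n`) + (unpaired summands). [folklore] -/
theorem Rt_split {n m : ℕ} [NeZero n] [NeZero m] (hnm : n ≤ m) (lam : Fin d) (p : Fin d → ℂ) :
    Rt m lam p = ∑ k ∈ univ.erase (fun _ => (0 : Fin n)), T166 m lam (iotaK n m hnm k) p
      + ∑ k' ∈ (univ.erase (fun _ => (0 : Fin m))).filter (fun k' => ¬ ∀ ν, Paired n m (k' ν)),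
          T166 m lam k' p := by
  rw [Rt_eq_sum, ← Finset.sum_filter_add_sum_filter_not _ (fun k' : Fin d → Fin m => ∀ ν, Paired n m (k' ν)),
    filter_paired_eq_image hnm, Finset.sum_image]
  intro k₁ _ k₂ _ h
  exact iotaK_injective hnm h

/-- the constant of the `R̃`-rate. [folklore] -/
def KR (d : ℕ) : ℝ := (KT d + 16384 / 7) * 256 ^ d

/-- `0 ≤ KR(d)`. [folklore] -/
theorem KR_nonneg (d : ℕ) : 0 ≤ KR d := by unfold KR; have := KT_nonneg d; positivity

/-- **THE RATE OF `R̃`**: `‖R̃_m − R̃_n‖ ≤ KR(d)/n²` on the fat box (`2 ≤ n ≤ m`). [folklore] -/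
theorem Rt_rate {n m : ℕ} [NeZero n] [NeZero m] (hn : 2 ≤ n) (hnm : n ≤ m) {r : ℝ} (hr : r ≤ 1 / 4)
    (hdr : (d : ℝ) * r ^ 2 ≤ 1 / 16) {p : Fin d → ℂ} (hp : p ∈ Fat d r) (lam : Fin d) :
    ‖Rt m lam p - Rt n lam p‖ ≤ KR d / (n : ℝ) ^ 2 := by
  have hn1 : 1 ≤ n := by omega
  have hKT := KT_nonneg d
  rw [Rt_split hnm, Rt_eq_sum n]
  have e : ∑ k ∈ univ.erase (fun _ => (0 : Fin n)), T166 m lam (iotaK n m hnm k) p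
        + ∑ k' ∈ (univ.erase (fun _ => (0 : Fin m))).filter (fun k' => ¬ ∀ ν, Paired n m (k' ν)),
            T166 m lam k' p
        - ∑ k ∈ univ.erase (fun _ => (0 : Fin n)), T166 n lam k p
      = ∑ k ∈ univ.erase (fun _ => (0 : Fin n)), (T166 m lam (iotaK n m hnm k) p - T166 n lam k p)
        + ∑ k' ∈ (univ.erase (fun _ => (0 : Fin m))).filter (fun k' => ¬ ∀ ν, Paired n m (k' ν)),
            T166 m lam k' p := by
    rw [Finset.sum_sub_distrib]; ring
  rw [e]
  calc _ ≤ ‖∑ k ∈ univ.erase (fun _ => (0 : Fin n)), (T166 m lam (iotaK n m hnm k) p - T166 n lam k p)‖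
        + ‖∑ k' ∈ (univ.erase (fun _ => (0 : Fin m))).filter (fun k' => ¬ ∀ ν, Paired n m (k' ν)),
            T166 m lam k' p‖ := norm_add_le _ _
    _ ≤ ∑ k ∈ univ.erase (fun _ => (0 : Fin n)), ‖T166 m lam (iotaK n m hnm k) p - T166 n lam k p‖
        + ∑ k' ∈ (univ.erase (fun _ => (0 : Fin m))).filter (fun k' => ¬ ∀ ν, Paired n m (k' ν)),
            ‖T166 m lam k' p‖ := add_le_add (norm_sum_le _ _) (norm_sum_le _ _)
    _ ≤ ∑ k ∈ univ.erase (fun _ => (0 : Fin n)), KT d / (n : ℝ) ^ 2 * cω n k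
        + ∑ k' ∈ (univ.erase (fun _ => (0 : Fin m))).filter (fun k' => ¬ ∀ ν, Paired n m (k' ν)),
            16384 / 7 / (n : ℝ) ^ 2 * cω m k' := by
        refine add_le_add (Finset.sum_le_sum (fun k hk => ?_)) (Finset.sum_le_sum (fun k' hk' => ?_))
        · exact T166_rate hn hnm hr hdr hp (Finset.mem_erase.mp hk).1 lam
        · have h1 := Finset.mem_filter.mp hk'
          exact norm_T166_unpaired_le hn1 hr hdr hp (Finset.mem_erase.mp h1.1).1 h1.2 lam
    _ ≤ ∑ k : Fin d → Fin n, KT d / (n : ℝ) ^ 2 * cω n k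
        + ∑ k' : Fin d → Fin m, 16384 / 7 / (n : ℝ) ^ 2 * cω m k' := by
        refine add_le_add ?_ ?_
        · exact Finset.sum_le_sum_of_subset_of_nonneg (Finset.erase_subset _ _)
            (fun k _ _ => by have := (cω_pos k).le; positivity)
        · exact Finset.sum_le_sum_of_subset_of_nonneg
            ((Finset.filter_subset _ _).trans (Finset.erase_subset _ _))
            (fun k _ _ => by have := (cω_pos k).le; positivity)
    _ = KT d / (n : ℝ) ^ 2 * ∑ k : Fin d → Fin n, cω n k
        + 16384 / 7 / (n : ℝ) ^ 2 * ∑ k' : Fin d → Fin m, cω m k' := by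
        rw [← Finset.mul_sum, ← Finset.mul_sum]
    _ ≤ KT d / (n : ℝ) ^ 2 * 256 ^ d + 16384 / 7 / (n : ℝ) ^ 2 * 256 ^ d :=
        add_le_add (mul_le_mul_of_nonneg_left (sum_cω_le n) (by positivity))
          (mul_le_mul_of_nonneg_left (sum_cω_le m) (by positivity))
    _ = KR d / (n : ℝ) ^ 2 := by unfold KR; ring

/-- rate-and-bound package of `R̃`: bound `Bc(d)`, rate `KR(d)/n²`. [folklore] -/
theorem Rt_RB {n m : ℕ} [NeZero n] [NeZero m] (hn : 2 ≤ n) (hnm : n ≤ m) {r : ℝ} (hr : r ≤ 1 / 4)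
    (hdr : (d : ℝ) * r ^ 2 ≤ 1 / 16) {p : Fin d → ℂ} (hp : p ∈ Fat d r) (lam : Fin d) :
    RB (Rt m lam p) (Rt n lam p) (Bc d) (KR d / (n : ℝ) ^ 2) :=
  ⟨norm_Rt_le_Bc m hr hdr hp lam, norm_Rt_le_Bc n hr hdr hp lam, Rt_rate hn hnm hr hdr hp lam⟩

/-! ### `c`, `Δ`, `Y`, `F`, and the multiplier -/

/-- the constant of the `c`-rate. [folklore] -/
def Kcf (d : ℕ) : ℝ := (4 * d + 1) * 4 ^ d * (16 * Cinv)

/-- `0 ≤ Kcf(d)`. [folklore] -/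
theorem Kcf_nonneg (d : ℕ) : 0 ≤ Kcf d := by unfold Kcf; have := Cinv_pos; positivity

/-- rate-and-bound package of the zero-alias `U`: bound `4^d`, rate `d·4^d·ρ(n)`. [folklore] -/
theorem U0_RB {n m : ℕ} [NeZero n] [NeZero m] (hn : 2 ≤ n) (hnm : n ≤ m) {r : ℝ} (hr : r ≤ 1 / 4)
    {p : Fin d → ℂ} (hp : p ∈ Fat d r) :
    RB (U m (fun _ => (0 : Fin m)) p) (U n (fun _ => (0 : Fin n)) p) (4 ^ d) (d * 4 ^ d * rho n) := by
  rw [U_zero_eq, U_zero_eq]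
  have h := RB.prod (Finset.univ : Finset (Fin d)) (f := fun lam => uFactor m 0 (p lam))
    (g := fun lam => uFactor n 0 (p lam)) (B := 4) (ρ := rho n) (by norm_num) (rho_nonneg n)
    (fun lam _ => uFactor_zero_RB hn hnm (fat_re hr hp lam) (fat_im hr hp lam))
  rw [Finset.card_univ, Fintype.card_fin] at h
  exact h

/-- `4^{d+1} ≤ Bc(d)`. [folklore] -/
theorem four_pow_succ_le_Bc (d : ℕ) : (4 : ℝ) ^ (d + 1) ≤ Bc d := by
  unfold Bc
  have h1 : (0 : ℝ) ≤ 16 * d := by positivity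
  have h3 : (0 : ℝ) ≤ 66 * 132 ^ d := by positivity
  linarith

/-- rate-and-bound package of `c`: bound `Bc(d)`, rate `Kcf(d)/n²`. [folklore] -/
theorem cfac_RB {n m : ℕ} [NeZero n] [NeZero m] (hn : 2 ≤ n) (hnm : n ≤ m) {r : ℝ} (hr : r ≤ 1 / 4)
    {p : Fin d → ℂ} (hp : p ∈ Fat d r) (lam : Fin d) :
    RB (cfac m lam p) (cfac n lam p) (Bc d) (Kcf d / (n : ℝ) ^ 2) := by
  unfold cfac
  have h := (U0_RB hn hnm hr hp).mul (uFactor_zero_RB hn hnm (fat_re hr hp lam) (fat_im hr hp lam))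
  refine h.mono ?_ (le_of_eq ?_)
  · rw [← pow_succ]; exact four_pow_succ_le_Bc d
  · unfold Kcf rho; ring

/-- the constant of the `Δ`-rate. [folklore] -/
def KΔ (d : ℕ) : ℝ := d * Cinv

/-- `0 ≤ KΔ(d)`. [folklore] -/
theorem KΔ_nonneg (d : ℕ) : 0 ≤ KΔ d := by unfold KΔ; have := Cinv_pos; positivity

/-- the leaf rate of `S_ξ` on the fat box in closed form: `‖S_ξ^{(m)}(z) − S_ξ^{(n)}(z)‖ ≤ Cinv/n²`. [folklore] -/
theorem norm_Sxi_sub_Sxi_fat {n m : ℕ} (hn : 2 ≤ n) (hnm : n ≤ m) {z : ℂ} (hx : |z.re| ≤ Real.pi + 1 / 4)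
    (hy : |z.im| ≤ 1 / 2) : ‖Sxi m z - Sxi n z‖ ≤ Cinv / (n : ℝ) ^ 2 := by
  have h := norm_Sxi_sub_Sxi_le (n := n) (m := m) (by omega) hnm z
  have hnr : (2 : ℝ) ≤ n := by exact_mod_cast hn
  have hz : ‖z‖ ≤ 4 := by
    have := Complex.norm_le_abs_re_add_abs_im z
    have := Real.pi_lt_d2
    linarith
  have hz4 : ‖z‖ ^ 4 ≤ 256 := by
    calc ‖z‖ ^ 4 ≤ (4 : ℝ) ^ 4 := pow_le_pow_left₀ (norm_nonneg _) hz 4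
      _ = 256 := by norm_num
  have hexp : Real.exp (‖z‖ / n) ≤ Real.exp (Real.pi + 2) := by
    rw [Real.exp_le_exp, div_le_iff₀ (by positivity)]
    nlinarith [Real.pi_pos]
  calc _ ≤ _ := h
    _ ≤ 4 * 256 * Real.exp (Real.pi + 2) / (n : ℝ) ^ 2 := by gcongr
    _ ≤ Cinv / (n : ℝ) ^ 2 := by
        unfold Cinv
        gcongr
        norm_num

/-- rate-and-bound package of the unshifted Laplacian symbol `Δ`: bound `Bc(d)`, rate `KΔ(d)/n²`. [folklore] -/
theorem DeltaXi0_RB {n m : ℕ} [NeZero n] [NeZero m] (hn : 2 ≤ n) (hnm : n ≤ m) {r : ℝ} (hr : r ≤ 1 / 4)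
    {p : Fin d → ℂ} (hp : p ∈ Fat d r) :
    RB (DeltaXi m 0 p) (DeltaXi n 0 p) (Bc d) (KΔ d / (n : ℝ) ^ 2) := by
  refine ⟨norm_DeltaXi0_le_Bc m hr hp, norm_DeltaXi0_le_Bc n hr hp, ?_⟩
  unfold DeltaXi
  simp only [Complex.ofReal_zero, add_zero]
  rw [← Finset.sum_sub_distrib]
  calc ‖∑ μ, (Sxi m (p μ) - Sxi n (p μ))‖ ≤ ∑ μ, ‖Sxi m (p μ) - Sxi n (p μ)‖ := norm_sum_le _ _
    _ ≤ ∑ _μ : Fin d, Cinv / (n : ℝ) ^ 2 :=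
        Finset.sum_le_sum (fun μ _ => norm_Sxi_sub_Sxi_fat hn hnm (fat_re hr hp μ) (fat_im hr hp μ))
    _ = KΔ d / (n : ℝ) ^ 2 := by
        rw [Finset.sum_const, Finset.card_univ, Fintype.card_fin, nsmul_eq_mul]; unfold KΔ; ring

/-- the constant of the `Y`-rate. [folklore] -/
def KY (d : ℕ) : ℝ := Kcf d + Bc d * (KR d + KΔ d)

/-- `0 ≤ KY(d)`. [folklore] -/
theorem KY_nonneg (d : ℕ) : 0 ≤ KY d := by
  unfold KY
  have := Kcf_nonneg d; have := KR_nonneg d; have := KΔ_nonneg d; have := Bc_pos d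
  positivity

/-- rate-and-bound package of `Y = c + Δ·R̃`: bound `2Bc(d)²`, rate `KY(d)/n²`. [folklore] -/
theorem Yc_RB {n m : ℕ} [NeZero n] [NeZero m] (hn : 2 ≤ n) (hnm : n ≤ m) {r : ℝ} (hr : r ≤ 1 / 4)
    (hdr : (d : ℝ) * r ^ 2 ≤ 1 / 16) {p : Fin d → ℂ} (hp : p ∈ Fat d r) (lam : Fin d) :
    RB (Yc m lam p) (Yc n lam p) (2 * Bc d ^ 2) (KY d / (n : ℝ) ^ 2) := by
  unfold Yc
  have h := (cfac_RB hn hnm hr hp lam).add ((DeltaXi0_RB hn hnm hr hp).mul (Rt_RB hn hnm hr hdr hp lam))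
  refine h.mono ?_ (le_of_eq ?_)
  · have := one_le_Bc d; nlinarith
  · unfold KY; ring

/-- weakening a product/power-shaped `RB` to exponent `d′` and a larger per-factor rate. [folklore] -/
theorem RB.mono_pow {a b : ℂ} {B ρ ρ₁ : ℝ} {c d' : ℕ} (h : RB a b (B ^ c) (c * B ^ c * ρ)) (hB : 1 ≤ B)
    (hcd : c ≤ d') (hρ0 : 0 ≤ ρ) (hρ : ρ ≤ ρ₁) : RB a b (B ^ d') (d' * B ^ d' * ρ₁) := by
  have h1 : B ^ c ≤ B ^ d' := pow_le_pow_right₀ hB hcd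
  have hc : (c : ℝ) ≤ d' := by exact_mod_cast hcd
  have hBc : 0 ≤ B ^ c := by positivity
  have hBd : 0 ≤ B ^ d' := by positivity
  refine h.mono h1 ?_
  calc (c : ℝ) * B ^ c * ρ ≤ d' * B ^ d' * ρ := by gcongr
    _ ≤ d' * B ^ d' * ρ₁ := by gcongr

/-- the uniform per-factor rate constant inside `F`'s monomials. [folklore] -/
def K1 (d : ℕ) : ℝ := KΔ d + KR d + Kcf d

/-- a monomial `Δ^{|T|−1} Π_T R̃ Π_{rest} c` of `F`: bound `(B^d)³`, rate `3d (B^d)³ K1/n²`. [folklore] -/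
theorem monomial_RB {n m : ℕ} [NeZero n] [NeZero m] (hn : 2 ≤ n) (hnm : n ≤ m) {r : ℝ} (hr : r ≤ 1 / 4)
    (hdr : (d : ℝ) * r ^ 2 ≤ 1 / 16) {p : Fin d → ℂ} (hp : p ∈ Fat d r) (lam : Fin d) (T : Finset (Fin d)) :
    RB (DeltaXi m 0 p ^ (T.card - 1) * ((∏ lam' ∈ T, Rt m lam' p) * ∏ lam' ∈ (univ.erase lam) \ T, cfac m lam' p))
       (DeltaXi n 0 p ^ (T.card - 1) * ((∏ lam' ∈ T, Rt n lam' p) * ∏ lam' ∈ (univ.erase lam) \ T, cfac n lam' p))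
       ((Bc d ^ d) ^ 3) (3 * d * (Bc d ^ d) ^ 3 * (K1 d / (n : ℝ) ^ 2)) := by
  have hB := one_le_Bc d
  have hKΔ := KΔ_nonneg d; have hKR := KR_nonneg d; have hKc := Kcf_nonneg d
  have hcardT : T.card ≤ d := (Finset.card_le_univ T).trans (by simp)
  have hcardS : ((univ.erase lam) \ T).card ≤ d := (Finset.card_le_univ _).trans (by simp)
  have i1 : KΔ d / (n : ℝ) ^ 2 ≤ K1 d / (n : ℝ) ^ 2 :=
    div_le_div_of_nonneg_right (by unfold K1; linarith) (by positivity)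
  have i2 : KR d / (n : ℝ) ^ 2 ≤ K1 d / (n : ℝ) ^ 2 :=
    div_le_div_of_nonneg_right (by unfold K1; linarith) (by positivity)
  have i3 : Kcf d / (n : ℝ) ^ 2 ≤ K1 d / (n : ℝ) ^ 2 :=
    div_le_div_of_nonneg_right (by unfold K1; linarith) (by positivity)
  have e1 : RB (DeltaXi m 0 p ^ (T.card - 1)) (DeltaXi n 0 p ^ (T.card - 1)) (Bc d ^ d)
      (d * Bc d ^ d * (K1 d / (n : ℝ) ^ 2)) :=
    ((DeltaXi0_RB hn hnm hr hp).pow hB (T.card - 1)).mono_pow hB (by omega) (by positivity) i1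
  have e2 : RB (∏ lam' ∈ T, Rt m lam' p) (∏ lam' ∈ T, Rt n lam' p) (Bc d ^ d)
      (d * Bc d ^ d * (K1 d / (n : ℝ) ^ 2)) :=
    (RB.prod T hB (by positivity) (fun lam' _ => Rt_RB hn hnm hr hdr hp lam')).mono_pow hB hcardT
      (by positivity) i2
  have e3 : RB (∏ lam' ∈ (univ.erase lam) \ T, cfac m lam' p) (∏ lam' ∈ (univ.erase lam) \ T, cfac n lam' p)
      (Bc d ^ d) (d * Bc d ^ d * (K1 d / (n : ℝ) ^ 2)) :=
    (RB.prod _ hB (by positivity) (fun lam' _ => cfac_RB hn hnm hr hp lam')).mono_pow hB hcardS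
      (by positivity) i3
  have h := e1.mul (e2.mul e3)
  exact h.mono (le_of_eq (by ring)) (le_of_eq (by ring))

/-- the `U_0`-rate constant. [folklore] -/
def KU (d : ℕ) : ℝ := d * 4 ^ d * (16 * Cinv)

/-- the constant of the `F`-rate. [folklore] -/
def KF (d : ℕ) : ℝ := d * Bc d ^ d * KU d + d * (Bc d * (2 ^ d * (3 * d * (Bc d ^ d) ^ 3 * K1 d)))

/-- `0 ≤ KF(d)`. [folklore] -/
theorem KF_nonneg (d : ℕ) : 0 ≤ KF d := by
  unfold KF KU K1
  have := KΔ_nonneg d; have := KR_nonneg d; have := Kcf_nonneg d; have := Bc_pos d; have := Cinv_pos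
  positivity

/-- **THE RATE OF THE DENOMINATOR `F`** on the fat box. [folklore] -/
theorem F66_RB {n m : ℕ} [NeZero n] [NeZero m] (hn : 2 ≤ n) (hnm : n ≤ m) {r : ℝ} (hr : r ≤ 1 / 4)
    (hdr : (d : ℝ) * r ^ 2 ≤ 1 / 16) {p : Fin d → ℂ} (hp : p ∈ Fat d r) :
    RB (F66 m p) (F66 n p) (MF d) (KF d / (n : ℝ) ^ 2) := by
  have hB := one_le_Bc d
  have hB0 := Bc_pos d
  -- the `U_0^d` term
  have hU0 : RB (U m (fun _ => (0 : Fin m)) p ^ d) (U n (fun _ => (0 : Fin n)) p ^ d) (Bc d ^ d)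
      (d * Bc d ^ d * (KU d / (n : ℝ) ^ 2)) := by
    have h4 : (4 : ℝ) ^ d ≤ Bc d :=
      (pow_le_pow_right₀ (by norm_num) (Nat.le_succ d)).trans (four_pow_succ_le_Bc d)
    have h0 := (U0_RB hn hnm hr hp).mono h4 (le_of_eq (by unfold KU rho; ring) :
      (d : ℝ) * 4 ^ d * rho n ≤ KU d / (n : ℝ) ^ 2)
    exact h0.pow hB d
  -- each `T`-monomial, the number of `T`'s
  have hcard : ∀ lam : Fin d, ((((univ.erase lam).powerset).erase ∅).card : ℝ) ≤ 2 ^ d := by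
    intro lam
    have h1 : (((univ.erase lam).powerset).erase ∅).card ≤ ((univ.erase lam).powerset).card :=
      Finset.card_erase_le
    rw [Finset.card_powerset] at h1
    have h2 : 2 ^ (univ.erase lam).card ≤ 2 ^ d :=
      Nat.pow_le_pow_right (by norm_num) ((Finset.card_le_univ _).trans (by simp))
    exact_mod_cast h1.trans h2
  have hK1n : 0 ≤ 3 * d * (Bc d ^ d) ^ 3 * (K1 d / (n : ℝ) ^ 2) := by
    have := KΔ_nonneg d; have := KR_nonneg d; have := Kcf_nonneg d
    unfold K1; positivity
  have hinner : ∀ lam : Fin d,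
      RB (S1 (p lam) * ∑ T ∈ ((univ.erase lam).powerset).erase ∅, DeltaXi m 0 p ^ (T.card - 1)
            * ((∏ lam' ∈ T, Rt m lam' p) * ∏ lam' ∈ (univ.erase lam) \ T, cfac m lam' p))
         (S1 (p lam) * ∑ T ∈ ((univ.erase lam).powerset).erase ∅, DeltaXi n 0 p ^ (T.card - 1)
            * ((∏ lam' ∈ T, Rt n lam' p) * ∏ lam' ∈ (univ.erase lam) \ T, cfac n lam' p))
         (Bc d * (2 ^ d * (Bc d ^ d) ^ 3)) (Bc d * (2 ^ d * (3 * d * (Bc d ^ d) ^ 3 * (K1 d / (n : ℝ) ^ 2)))) := by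
    intro lam
    have hs := RB.sum (((univ.erase lam).powerset).erase ∅) (fun T _ => monomial_RB hn hnm hr hdr hp lam T)
    have hs' := hs.mono
      (mul_le_mul_of_nonneg_right (hcard lam) (by positivity) :
        ((((univ.erase lam).powerset).erase ∅).card : ℝ) * (Bc d ^ d) ^ 3 ≤ 2 ^ d * (Bc d ^ d) ^ 3)
      (mul_le_mul_of_nonneg_right (hcard lam) hK1n)
    have hS1 := RB.of_eq (S1 (p lam)) (norm_S1_le_Bc hr hp lam)
    have h := hS1.mul hs'
    exact h.mono le_rfl (le_of_eq (by ring))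
  have hsum := RB.sum (Finset.univ : Finset (Fin d)) (fun lam _ => hinner lam)
  rw [Finset.card_univ, Fintype.card_fin] at hsum
  have h := hU0.add hsum
  unfold F66
  refine h.mono (le_of_eq ?_) (le_of_eq ?_)
  · unfold MF; ring
  · unfold KF; ring

/-- the numerator `Π_{λ∉{μ,ν}} Y_λ`: bound `(2B²)^d`, rate `d (2B²)^d KY/n²`. [folklore] -/
theorem prodYc_RB {n m : ℕ} [NeZero n] [NeZero m] (hn : 2 ≤ n) (hnm : n ≤ m) {r : ℝ} (hr : r ≤ 1 / 4)
    (hdr : (d : ℝ) * r ^ 2 ≤ 1 / 16) {p : Fin d → ℂ} (hp : p ∈ Fat d r) (μ ν : Fin d) :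
    RB (∏ lam ∈ (univ.erase μ).erase ν, Yc m lam p) (∏ lam ∈ (univ.erase μ).erase ν, Yc n lam p)
      ((2 * Bc d ^ 2) ^ d) (d * (2 * Bc d ^ 2) ^ d * (KY d / (n : ℝ) ^ 2)) := by
  have hB := one_le_Bc d
  have hB2 : 1 ≤ 2 * Bc d ^ 2 := by nlinarith
  have hKY : 0 ≤ KY d / (n : ℝ) ^ 2 := by have := KY_nonneg d; positivity
  have hcard : ((univ.erase μ).erase ν).card ≤ d := (Finset.card_le_univ _).trans (by simp)
  exact (RB.prod _ hB2 hKY (fun lam _ => Yc_RB hn hnm hr hdr hp lam)).mono_pow hB2 hcard hKY le_rfl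

/-- the zero-free lower bound constant of `F` on the strip (`B5Symbol166Strip.F66_lower`). [folklore] -/
def c0 (d : ℕ) : ℝ := ((4 / Real.pi ^ 2) ^ d) ^ d / 2

/-- `0 < c0(d)`. [folklore] -/
theorem c0_pos (d : ℕ) : 0 < c0 d := by unfold c0; positivity

/-- the constant of the multiplier rate for `n ≥ 2`. [folklore] -/
def KW (d : ℕ) : ℝ := d * (2 * Bc d ^ 2) ^ d * KY d / c0 d + (2 * Bc d ^ 2) ^ d * KF d / c0 d ^ 2

/-- `0 ≤ KW(d)`. [folklore] -/
theorem KW_nonneg (d : ℕ) : 0 ≤ KW d := by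
  unfold KW
  have := KY_nonneg d; have := KF_nonneg d; have := Bc_pos d; have := c0_pos d
  positivity

/-- **THE η-RATE OF THE CONTINUED (1.66) MULTIPLIER ON THE FULL ZERO-FREE STRIP, levels `2 ≤ n ≤ m`**. [folklore] -/
theorem W166_rate_two {n m : ℕ} [NeZero n] [NeZero m] (hn : 2 ≤ n) (hnm : n ≤ m) {κ : ℝ} (hκ0 : 0 ≤ κ)
    (hκ : κ ≤ kappa166 d) {p : Fin d → ℂ} (hp : p ∈ Strip d κ) (μ ν : Fin d) :
    ‖W166 m μ ν p - W166 n μ ν p‖ ≤ KW d / (n : ℝ) ^ 2 := by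
  have hκr : κ ≤ rOf d := hκ.trans (kappa166_le_rOf d)
  have hfat : p ∈ Fat d (rOf d) := strip_subset_fat (rOf_pos d).le hκr hp
  have hr := rOf_le d
  have hdr := d_mul_rOf_sq_le d
  have hN := prodYc_RB hn hnm hr hdr hfat μ ν
  have hF := F66_RB hn hnm hr hdr hfat
  have hFm := F66_lower m hκ0 hκ p hp
  have hFn := F66_lower n hκ0 hκ p hp
  unfold W166
  have h := norm_div_sub_div_le (c0_pos d) hN.left hN.sub hF.sub (by unfold c0; exact hFm)
    (by unfold c0; exact hFn)
  refine h.trans (le_of_eq ?_)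
  unfold KW
  ring

/-- the constant of the multiplier rate for all levels `1 ≤ n ≤ m`. [folklore] -/
def C166 (d : ℕ) : ℝ := KW d + 2 * MW d

/-- `0 < C166(d)`. [folklore] -/
theorem C166_pos (d : ℕ) : 0 < C166 d := by
  unfold C166; have := KW_nonneg d; have := MW_pos d; positivity

/-- **THE η-RATE OF THE CONTINUED (1.66) MULTIPLIER ON THE FULL ZERO-FREE STRIP AT KING'S EXPONENT**:
for all levels `1 ≤ n ≤ m` (no divisibility), all `μ ν`, `0 ≤ κ ≤ κ₁₆₆(d)` and `p ∈ Strip d κ`,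
`‖W166 m μ ν p − W166 n μ ν p‖ ≤ C166(d)/n²`.  ([King1986] (4.31) p. 673 exponent `L^{−2k}`, Bałaban's (1.66) symbol,
hypothesis-free.) [folklore] -/
theorem W166_rate {n m : ℕ} [NeZero n] [NeZero m] (hnm : n ≤ m) {κ : ℝ} (hκ0 : 0 ≤ κ)
    (hκ : κ ≤ kappa166 d) {p : Fin d → ℂ} (hp : p ∈ Strip d κ) (μ ν : Fin d) :
    ‖W166 m μ ν p - W166 n μ ν p‖ ≤ C166 d / (n : ℝ) ^ 2 := by
  have hn1 : 1 ≤ n := Nat.one_le_iff_ne_zero.mpr (NeZero.ne n)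
  have hKW := KW_nonneg d
  have hMW := MW_pos d
  rcases (show n = 1 ∨ 2 ≤ n by omega) with h1 | h2
  · subst h1
    have ha := norm_W166_le m hκ0 hκ hp μ ν
    have hb := norm_W166_le 1 hκ0 hκ hp μ ν
    calc _ ≤ ‖W166 m μ ν p‖ + ‖W166 1 μ ν p‖ := norm_sub_le _ _
      _ ≤ MW d + MW d := add_le_add ha hb
      _ ≤ C166 d / ((1 : ℕ) : ℝ) ^ 2 := by push_cast; unfold C166; rw [one_pow, div_one]; linarith
  · exact (W166_rate_two h2 hnm hκ0 hκ hp μ ν).trans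
      (div_le_div_of_nonneg_right (by unfold C166; linarith) (by positivity))

/-- the same rate in King's level notation `n = L^k`, `m = L^{k+j}` (`L ≥ 1`). [folklore] -/
theorem W166_rate_pow {L : ℕ} (hL : 1 ≤ L) (k j : ℕ) {κ : ℝ} (hκ0 : 0 ≤ κ) (hκ : κ ≤ kappa166 d)
    {p : Fin d → ℂ} (hp : p ∈ Strip d κ) (μ ν : Fin d) :
    haveI : NeZero (L ^ k) := ⟨by positivity⟩
    haveI : NeZero (L ^ (k + j)) := ⟨by positivity⟩
    ‖W166 (L ^ (k + j)) μ ν p - W166 (L ^ k) μ ν p‖ ≤ C166 d / (((L : ℝ) ^ k) ^ 2) := by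
  haveI : NeZero (L ^ k) := ⟨by positivity⟩
  haveI : NeZero (L ^ (k + j)) := ⟨by positivity⟩
  have h := W166_rate (n := L ^ k) (m := L ^ (k + j)) (Nat.pow_le_pow_right hL (by omega)) hκ0 hκ hp μ ν
  simpa using h

/-! ## §3  The continuum multiplier on the strip (King (4.31) literally) and position space at the full exponent -/

section Limit

open Filter Topology

/-- the CONTINUUM (1.66) multiplier on the strip: the limit of `W166 n μ ν p` as `n → ∞` (it exists on the zero-free
strip by the Cauchy estimate `W166_rate`; junk elsewhere). [folklore] -/
def W166lim (μ ν : Fin d) (p : Fin d → ℂ) : ℂ := limUnder atTop (fun j : ℕ => W166 (j + 1) μ ν p)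

/-- `n ↦ W166 (n+1) μ ν p` is a Cauchy sequence on the zero-free strip (from `W166_rate`). [folklore] -/
theorem W166_cauchySeq {κ : ℝ} (hκ0 : 0 ≤ κ) (hκ : κ ≤ kappa166 d) {p : Fin d → ℂ} (hp : p ∈ Strip d κ)
    (μ ν : Fin d) : CauchySeq (fun j : ℕ => W166 (j + 1) μ ν p) := by
  have hC := (C166_pos d).le
  refine cauchySeq_of_le_tendsto_0 (fun N : ℕ => C166 d * (1 / ((N : ℝ) + 1))) (fun j i N hj hi => ?_) ?_
  · have key : ∀ a b : ℕ, N ≤ a → a ≤ b →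
        dist (W166 (a + 1) μ ν p) (W166 (b + 1) μ ν p) ≤ C166 d * (1 / ((N : ℝ) + 1)) := by
      intro a b ha hab
      rw [dist_eq_norm, norm_sub_rev]
      have h := W166_rate (n := a + 1) (m := b + 1) (by omega) hκ0 hκ hp μ ν
      refine h.trans ?_
      have hN : (N : ℝ) + 1 ≤ (a : ℝ) + 1 := by exact_mod_cast Nat.succ_le_succ ha
      have hN0 : (0 : ℝ) < (N : ℝ) + 1 := by positivity
      push_cast
      rw [mul_one_div]
      calc C166 d / ((a : ℝ) + 1) ^ 2 ≤ C166 d / ((a : ℝ) + 1) := by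
            refine div_le_div_of_nonneg_left hC (by positivity) ?_
            nlinarith
        _ ≤ C166 d / ((N : ℝ) + 1) := div_le_div_of_nonneg_left hC hN0 hN
    rcases le_total j i with h | h
    · exact key j i hj h
    · rw [dist_comm]; exact key i j hi h
  · simpa using (tendsto_one_div_add_atTop_nhds_zero_nat.const_mul (C166 d))

/-- `W166 (n+1) μ ν p → W166lim μ ν p` on the zero-free strip. [folklore] -/
theorem tendsto_W166lim {κ : ℝ} (hκ0 : 0 ≤ κ) (hκ : κ ≤ kappa166 d) {p : Fin d → ℂ} (hp : p ∈ Strip d κ)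
    (μ ν : Fin d) : Tendsto (fun j : ℕ => W166 (j + 1) μ ν p) atTop (𝓝 (W166lim μ ν p)) :=
  tendsto_nhds_limUnder (cauchySeq_tendsto_of_complete (W166_cauchySeq hκ0 hκ hp μ ν))

/-- **KING'S (4.31) FOR BAŁABAN'S (1.66) ON THE COMPLEX STRIP**: `‖W166_∞(p) − W166_n(p)‖ ≤ C166(d)/n²` for every `n ≥ 1`
and every `p` in the zero-free strip — the η-rate of convergence of the linear (U = 1) block-spin multiplier to its
continuum limit (exponent of [King1986] (4.31) p. 673, `|Δ^{(k+n)}(p′+l)⁻¹ − Δ^{(k)}(p′+l)⁻¹| ≤ CL^{−2k}`, here for the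
whole (1.66) multiplier, on the complex strip in place of the real Brillouin zone, with an explicit constant). [folklore] -/
theorem W166lim_rate {κ : ℝ} (hκ0 : 0 ≤ κ) (hκ : κ ≤ kappa166 d) {p : Fin d → ℂ} (hp : p ∈ Strip d κ)
    (μ ν : Fin d) (n : ℕ) [NeZero n] : ‖W166lim μ ν p - W166 n μ ν p‖ ≤ C166 d / (n : ℝ) ^ 2 := by
  have hn1 : 1 ≤ n := Nat.one_le_iff_ne_zero.mpr (NeZero.ne n)
  have ht := tendsto_W166lim hκ0 hκ hp μ ν
  have ht' : Tendsto (fun j : ℕ => ‖W166 (j + 1) μ ν p - W166 n μ ν p‖) atTop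
      (𝓝 ‖W166lim μ ν p - W166 n μ ν p‖) := (ht.sub_const _).norm
  refine le_of_tendsto ht' ?_
  rw [Filter.eventually_atTop]
  refine ⟨n, fun j hj => ?_⟩
  exact W166_rate (n := n) (m := j + 1) (by omega) hκ0 hκ hp μ ν

/-- the continuum multiplier is bounded by `MW` on the strip. [folklore] -/
theorem norm_W166lim_le {κ : ℝ} (hκ0 : 0 ≤ κ) (hκ : κ ≤ kappa166 d) {p : Fin d → ℂ} (hp : p ∈ Strip d κ)
    (μ ν : Fin d) : ‖W166lim μ ν p‖ ≤ MW d := by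
  have ht := (tendsto_W166lim hκ0 hκ hp μ ν).norm
  refine le_of_tendsto ht ?_
  rw [Filter.eventually_atTop]
  exact ⟨0, fun j _ => norm_W166_le (j + 1) hκ0 hκ hp μ ν⟩

end Limit

section Position

open Literature.MathematicalPhysics.QuantumFieldTheory.Balaban1983to89.B4ContourShift (StripRegular latticeKernel
  latticeKernel_decay supNorm)
open Literature.MathematicalPhysics.QuantumFieldTheory.Balaban1983to89.B4Green242Bridge (latticeKernel_sub)
open Literature.MathematicalPhysics.QuantumFieldTheory.Balaban1983to89.T4GaugeActionRateStrip (exp_add_one_le_four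
  torusKernel_descendC_sub)
open Literature.MathematicalPhysics.QuantumFieldTheory.Balaban1983to89.T4GaugeActionRatePair (kerRe kerFamily kerMatrix
  exp_sup_le_exp_l1 kerRe_decay)
open Literature.MathematicalPhysics.QuantumFieldTheory.Balaban1983to89.B12Sec2to5 (l1 l1_nonneg Decay510)
open Literature.MathematicalPhysics.QuantumFieldTheory.Balaban1983to89.T4RateAlgebra (RatePair step step_apply
  UnitStepIneq unitStepIneq_iff ratePair_iff_uniformDecay_and_stepRate kernelInputsOfRatePair)

/-- `κ₁₆₆(d) ≤ 1`. [folklore] -/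
theorem kappa166_le_one (d : ℕ) : kappa166 d ≤ 1 :=
  ((kappa166_le_rOf d).trans (rOf_le d)).trans (by norm_num)

/-- **THE STRIP RATE OF THE ENTRY SYMBOL** `Gsym = ½·W·(e^{−ip_a} − 1)(e^{ip_b} − 1)` at the full exponent and width:
`‖Gsym^{(m)} − Gsym^{(n)}‖ ≤ 8·C166(d)/n²` on `Strip d κ`, `κ ≤ κ₁₆₆(d)`, `n ≤ m`. [folklore] -/
theorem Gsym_rate {n m : ℕ} [NeZero n] [NeZero m] (hnm : n ≤ m) {κ : ℝ} (hκ0 : 0 ≤ κ) (hκ : κ ≤ kappa166 d)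
    (μ ν a b : Fin d) {p : Fin d → ℂ} (hp : p ∈ Strip d κ) :
    ‖Gsym m μ ν a b p - Gsym n μ ν a b p‖ ≤ 8 * C166 d / (n : ℝ) ^ 2 := by
  have hW := W166_rate hnm hκ0 hκ hp μ ν
  have he := exp_add_one_le_four (hκ.trans (kappa166_le_one d))
  have hN := ((norm_expFac_le hp a).1).trans he
  have hP := ((norm_expFac_le hp b).2).trans he
  have hC := (C166_pos d).le
  unfold Gsym
  rw [show 1 / 2 * W166 m μ ν p * (expFacNeg a p * expFacPos b p)
      - 1 / 2 * W166 n μ ν p * (expFacNeg a p * expFacPos b p)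
      = 1 / 2 * ((W166 m μ ν p - W166 n μ ν p) * (expFacNeg a p * expFacPos b p)) by ring,
    norm_mul, norm_mul, norm_mul]
  have h12 : ‖(1 / 2 : ℂ)‖ = 1 / 2 := by norm_num
  rw [h12]
  calc 1 / 2 * (‖W166 m μ ν p - W166 n μ ν p‖ * (‖expFacNeg a p‖ * ‖expFacPos b p‖))
      ≤ 1 / 2 * (C166 d / (n : ℝ) ^ 2 * (4 * 4)) := by gcongr
    _ = 8 * C166 d / (n : ℝ) ^ 2 := by ring

/-- the DIFFERENCE `W^{(m)} − W^{(n)}` is strip regular on `Strip (d+1) κ` for the FULL width `0 ≤ κ ≤ κ₁₆₆(d+1)`, with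
bound THE RATE `C166(d+1)/n²`. [folklore] -/
theorem stripRegular_W166_sub2 {n m : ℕ} [NeZero n] [NeZero m] (hnm : n ≤ m) {κ : ℝ} (hκ0 : 0 ≤ κ)
    (hκ : κ ≤ kappa166 (d + 1)) {μ ν : Fin (d + 1)} (hμν : μ ≠ ν) :
    StripRegular (d := d) (fun p => W166 m μ ν p - W166 n μ ν p) κ (C166 (d + 1) / (n : ℝ) ^ 2) := by
  have h₂ := stripRegular_W166 (d := d) m hκ0 hκ hμν
  have h₁ := stripRegular_W166 (d := d) n hκ0 hκ hμν
  refine ⟨h₂.cont.sub h₁.cont, fun i q hq => (h₂.diff i q hq).sub (h₁.diff i q hq), ?_, ?_⟩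
  · intro i q hq y hy
    show W166 m μ ν _ - W166 n μ ν _ = W166 m μ ν _ - W166 n μ ν _
    rw [h₂.sides i q hq y hy, h₁.sides i q hq y hy]
  · intro p hp
    exact W166_rate hnm hκ0 hκ hp μ ν

/-- the DIFFERENCE `Gsym^{(m)} − Gsym^{(n)}` is strip regular at full width with bound `8·C166(d+1)/n²`. [folklore] -/
theorem stripRegular_Gsym_sub2 {n m : ℕ} [NeZero n] [NeZero m] (hnm : n ≤ m) {κ : ℝ} (hκ0 : 0 ≤ κ)
    (hκ : κ ≤ kappa166 (d + 1)) {μ ν : Fin (d + 1)} (hμν : μ ≠ ν) (a b : Fin (d + 1)) :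
    StripRegular (d := d) (fun p => Gsym m μ ν a b p - Gsym n μ ν a b p) κ (8 * C166 (d + 1) / (n : ℝ) ^ 2) := by
  have h₂ := stripRegular_Gsym (d := d) m hκ0 hκ hμν a b
  have h₁ := stripRegular_Gsym (d := d) n hκ0 hκ hμν a b
  refine ⟨h₂.cont.sub h₁.cont, fun i q hq => (h₂.diff i q hq).sub (h₁.diff i q hq), ?_, ?_⟩
  · intro i q hq y hy
    show Gsym m μ ν a b _ - Gsym n μ ν a b _ = Gsym m μ ν a b _ - Gsym n μ ν a b _
    rw [h₂.sides i q hq y hy, h₁.sides i q hq y hy]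
  · intro p hp
    exact Gsym_rate hnm hκ0 hκ μ ν a b hp

/-- POSITION SPACE ON `ℤ^{d+1}` at the full exponent and width:
`‖K^{(m)}(x) − K^{(n)}(x)‖ ≤ 8·C166(d+1)/n² · e^{−κ₁₆₆(d+1)|x|_∞}`. [folklore] -/
theorem latticeKernel_Gsym_rate2 {n m : ℕ} [NeZero n] [NeZero m] (hnm : n ≤ m) {μ ν : Fin (d + 1)} (hμν : μ ≠ ν)
    (a b : Fin (d + 1)) (x : Fin (d + 1) → ℤ) :
    ‖latticeKernel (fun p => Gsym m μ ν a b p - Gsym n μ ν a b p) x‖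
      ≤ 8 * C166 (d + 1) / (n : ℝ) ^ 2 * Real.exp (-(kappa166 (d + 1) * supNorm x)) := by
  have hκ0 : 0 ≤ kappa166 (d + 1) := (kappa166_pos (d + 1)).le
  exact latticeKernel_decay (stripRegular_Gsym_sub2 hnm hκ0 le_rfl hμν a b) hκ0 x

/-- the two-lattice step bound for the real entry kernels at the full exponent and the (UD) decay rate:
`|Re K^{(m)}(x) − Re K^{(n)}(x)| ≤ 8·C166(d+1)/n² · e^{−(κ₁₆₆(d+1)/(d+1))|x|₁}`. [folklore] -/
theorem kerRe_step2 {n m : ℕ} [NeZero n] [NeZero m] (hnm : n ≤ m) {μ ν : Fin (d + 1)} (hμν : μ ≠ ν)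
    (a b : Fin (d + 1)) (x : Fin (d + 1) → ℤ) :
    |kerRe m μ ν a b x - kerRe n μ ν a b x|
      ≤ 8 * C166 (d + 1) / (n : ℝ) ^ 2 * Real.exp (-(kappa166 (d + 1) / ((d : ℝ) + 1)) * l1 x) := by
  have hκ : 0 ≤ kappa166 (d + 1) := (kappa166_pos (d + 1)).le
  have I₁ := (stripRegular_Gsym (d := d) n hκ le_rfl hμν a b).integrableOn hκ x
  have I₂ := (stripRegular_Gsym (d := d) m hκ le_rfl hμν a b).integrableOn hκ x
  have hsub : latticeKernel (fun p => Gsym m μ ν a b p - Gsym n μ ν a b p) x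
      = latticeKernel (fun p => Gsym m μ ν a b p) x - latticeKernel (fun p => Gsym n μ ν a b p) x :=
    latticeKernel_sub x I₂ I₁
  have hr := latticeKernel_Gsym_rate2 (d := d) hnm hμν a b x
  rw [hsub] at hr
  have h2 := exp_sup_le_exp_l1 (d := d) hκ x
  have hC : 0 ≤ 8 * C166 (d + 1) / (n : ℝ) ^ 2 := by have := C166_pos (d + 1); positivity
  calc |kerRe m μ ν a b x - kerRe n μ ν a b x|
        = |(latticeKernel (fun p => Gsym m μ ν a b p) x - latticeKernel (fun p => Gsym n μ ν a b p) x).re| := by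
          simp only [kerRe, Complex.sub_re]
    _ ≤ ‖latticeKernel (fun p => Gsym m μ ν a b p) x - latticeKernel (fun p => Gsym n μ ν a b p) x‖ :=
          abs_re_le_norm _
    _ ≤ 8 * C166 (d + 1) / (n : ℝ) ^ 2 * Real.exp (-(kappa166 (d + 1) * supNorm x)) := hr
    _ ≤ 8 * C166 (d + 1) / (n : ℝ) ^ 2 * Real.exp (-(kappa166 (d + 1) / ((d : ℝ) + 1)) * l1 x) :=
          mul_le_mul_of_nonneg_left h2 hC

/-- **RATE PAIR FOR THE (1.66) LAYER AT KING'S EXPONENT**: for every `L ≥ 1`, `μ ≠ ν`, `a`, `b`,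
`RatePair (kerFamily L μ ν a b) (MG(d+1)) (κ₁₆₆(d+1)/(d+1)) (8·C166(d+1)) (L⁻²)` — (UD) at the full width and (PR′)
`|X_{k+1}(x) − X_k(x)| ≤ 8·C166·L^{−2k}·e^{−(κ₁₆₆/(d+1))|x|₁}` (gen 2: `θ = L⁻¹`, `δ = κ₁₆₆/(4(d+1)²)`). [folklore] -/
theorem ratePair_kerFamily2 (L : ℕ) [NeZero L] {μ ν : Fin (d + 1)} (hμν : μ ≠ ν) (a b : Fin (d + 1)) :
    RatePair (kerFamily (d := d) L μ ν a b) (MG (d + 1)) (kappa166 (d + 1) / ((d : ℝ) + 1))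
      (8 * C166 (d + 1)) (((L : ℝ) ^ 2)⁻¹) where
  decay k := kerRe_decay (d := d) (L ^ k) hμν a b
  rate k := by
    intro x
    have hL : 1 ≤ L := Nat.one_le_iff_ne_zero.mpr (NeZero.ne L)
    have h := kerRe_step2 (d := d) (n := L ^ k) (m := L ^ (k + 1)) (Nat.pow_le_pow_right hL (Nat.le_succ k)) hμν a b x
    have e : 8 * C166 (d + 1) / (((L ^ k : ℕ) : ℝ)) ^ 2 = 8 * C166 (d + 1) * (((L : ℝ) ^ 2)⁻¹) ^ k := by
      rw [Nat.cast_pow, inv_pow, ← pow_mul, ← pow_mul, mul_comm k 2, div_eq_mul_inv]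
    rw [e] at h
    rw [step_apply]
    exact h

/-- T4 reading: `UnitStepIneq` holds for the (1.66) entry kernels with `B₀ = 8·C166(d+1)`, `δ₀ = κ₁₆₆(d+1)/(d+1)`,
`θ = L⁻²`. [folklore] -/
theorem unitStepIneq_kerFamily2 (L : ℕ) [NeZero L] {μ ν : Fin (d + 1)} (hμν : μ ≠ ν) (a b : Fin (d + 1)) :
    UnitStepIneq (kerFamily (d := d) L μ ν a b) (8 * C166 (d + 1)) (kappa166 (d + 1) / ((d : ℝ) + 1))
      (((L : ℝ) ^ 2)⁻¹) :=
  (unitStepIneq_iff _ _ _ _).mpr (ratePair_kerFamily2 L hμν a b).rate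

/-- β reading: `UniformDecay ∧ StepRate` of every component of `kerMatrix L μ ν` with `θ = L⁻²`. [folklore] -/
theorem uniformDecay_and_stepRate_kerMatrix2 (L : ℕ) [NeZero L] {μ ν : Fin (d + 1)} (hμν : μ ≠ ν)
    (a b : Fin (d + 1)) :
    Beta.LimitRate.UniformDecay (kerMatrix (d := d) L μ ν) a b (MG (d + 1)) (kappa166 (d + 1) / ((d : ℝ) + 1)) ∧
      Beta.LimitRate.StepRate (kerMatrix (d := d) L μ ν) a b (8 * C166 (d + 1))
        (kappa166 (d + 1) / ((d : ℝ) + 1)) (((L : ℝ) ^ 2)⁻¹) :=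
  (ratePair_iff_uniformDecay_and_stepRate (kerMatrix L μ ν) a b _ _ _ _).mp (ratePair_kerFamily2 L hμν a b)

/-- `θ = L⁻² < 1` for `L ≥ 2`. [folklore] -/
theorem thetaSq_lt_one {L : ℕ} (hL : 2 ≤ L) : ((L : ℝ) ^ 2)⁻¹ < 1 := by
  have hL' : (2 : ℝ) ≤ L := by exact_mod_cast hL
  exact inv_lt_one_of_one_lt₀ (by nlinarith)

/-- `0 ≤ L⁻²`. [folklore] -/
theorem thetaSq_nonneg (L : ℕ) : 0 ≤ ((L : ℝ) ^ 2)⁻¹ := by positivity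

/-- the β socket `KernelInputs` inhabited with `θ = L⁻²` (same caveat as `T4GaugeActionRatePair.kernelInputs166`:
`kerMatrix` is NOT `Π⁰`). [folklore] -/
def kernelInputs166sq (L : ℕ) [NeZero L] (hL : 2 ≤ L) {μ ν : Fin (d + 1)} (hμν : μ ≠ ν) {a b : Fin (d + 1)}
    (hab : a ≠ b) : Beta.LimitRate.KernelInputs (d + 1) (kerMatrix (d := d) L μ ν) :=
  kernelInputsOfRatePair hab (by have := kappa166_pos (d + 1); positivity) (thetaSq_nonneg L) (thetaSq_lt_one hL)
    (ratePair_kerFamily2 L hμν a b)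

/-- summary in the consumers' quantifier shape, now with `θ = L⁻²`. [folklore] -/
theorem exists_ratePair_166sq (L : ℕ) [NeZero L] (hL : 2 ≤ L) {μ ν : Fin (d + 1)} (hμν : μ ≠ ν)
    (a b : Fin (d + 1)) :
    ∃ C δ C' θ : ℝ, 0 < δ ∧ 0 ≤ θ ∧ θ < 1 ∧ θ = ((L : ℝ) ^ 2)⁻¹ ∧
      RatePair (kerFamily (d := d) L μ ν a b) C δ C' θ :=
  ⟨_, _, _, _, by have := kappa166_pos (d + 1); positivity, thetaSq_nonneg L, thetaSq_lt_one hL, rfl,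
    ratePair_kerFamily2 L hμν a b⟩

section Torus

open Literature.MathematicalPhysics.QuantumFieldTheory.Balaban1983to89.B4TorusKernel
  (descend descendC descendC_apply periodConst)
open Literature.MathematicalPhysics.QuantumFieldTheory.Balaban1983to89.B4TorusKernel.MultiPeriod
  (torusSum torusKernel torusSupNorm torusKernel_descend_decay_torusMetric)
open Literature.MathematicalPhysics.QuantumFieldTheory.Balaban1983to89.B6LowerBound2153Torus (toT)
open Literature.MathematicalPhysics.QuantumFieldTheory.Balaban1983to89.B6Cov2156Torus (one_le_M)
open Literature.MathematicalPhysics.QuantumFieldTheory.Balaban1983to89.B5Kernel166Decay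
  (ksum ksum_toT_eq_torusKernel)

variable (M : Fin (d + 1) → ℕ) [hM : ∀ μ, NeZero (M μ)]

/-- **THE η-RATE OF THE KERNELS OF BAŁABAN'S `Δ_k` (U = 1) IN POSITION SPACE ON EVERY TORUS, AT KING'S EXPONENT AND THE
FULL DECAY RATE, UNIFORMLY IN THE VOLUME**: for `n ≤ m`, `μ ≠ ν`, all `a, b`, every period vector `M` and lattice vector `x`,
`‖ksum_M^{(m)}(x̄) − ksum_M^{(n)}(x̄)‖ ≤ 8·C166(d+1)/n² · periodConst(κ₁₆₆(d+1)) · e^{−(κ₁₆₆(d+1)/(d+1))·|x|_{T,∞}}`.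
[cite: Balaban1984PropagatorsI, (1.66) p.29 (location only)] [folklore] -/
theorem ksum_rate2 {n m : ℕ} [NeZero n] [NeZero m] (hnm : n ≤ m) {μ ν : Fin (d + 1)} (hμν : μ ≠ ν)
    (a b : Fin (d + 1)) (x : Fin (d + 1) → ℤ) :
    ‖ksum M m μ ν a b (toT M x) - ksum M n μ ν a b (toT M x)‖
      ≤ 8 * C166 (d + 1) / (n : ℝ) ^ 2 * periodConst (kappa166 (d + 1)) d
          * Real.exp (-(kappa166 (d + 1) / (d + 1) * torusSupNorm M x)) := by
  have hκ0 : 0 < kappa166 (d + 1) := kappa166_pos (d + 1)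
  rw [ksum_toT_eq_torusKernel M m hκ0 le_rfl hμν a b x, ksum_toT_eq_torusKernel M n hκ0 le_rfl hμν a b x,
    torusKernel_descendC_sub (stripRegular_Gsym n hκ0.le le_rfl hμν a b)
      (stripRegular_Gsym m hκ0.le le_rfl hμν a b) (stripRegular_Gsym_sub2 hnm hκ0.le le_rfl hμν a b) hκ0.le M x]
  exact torusKernel_descend_decay_torusMetric _ hκ0 (one_le_M M) x

/-- King's shape: `n = L^k`, `m = L^{k+j}`, amplitude `8·C166(d+1)·L^{−2k}`. [folklore] -/
theorem ksum_rate2_king (L k j : ℕ) [NeZero L] {μ ν : Fin (d + 1)} (hμν : μ ≠ ν) (a b : Fin (d + 1))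
    (x : Fin (d + 1) → ℤ) :
    ‖ksum M (L ^ (k + j)) μ ν a b (toT M x) - ksum M (L ^ k) μ ν a b (toT M x)‖
      ≤ 8 * C166 (d + 1) / (((L : ℝ) ^ k) ^ 2) * periodConst (kappa166 (d + 1)) d
          * Real.exp (-(kappa166 (d + 1) / (d + 1) * torusSupNorm M x)) := by
  have hL : 1 ≤ L := Nat.one_le_iff_ne_zero.mpr (NeZero.ne L)
  have h := ksum_rate2 M (n := L ^ k) (m := L ^ (k + j)) (Nat.pow_le_pow_right hL (by omega)) hμν a b x
  simpa using h

end Torus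

end Position

end

end Literature.MathematicalPhysics.QuantumFieldTheory.Balaban1983to89.T4Rate166StripDirect
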